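import Summits.CriticalPhenomena.PercolationContinuityZ3.Theses.PercNearOneGluing
import Literature.Probability.LatticeModels.ProdBernoulliIndependence
import Literature.Probability.Percolation.KozmaNitzanReduction

/-!
# Disproof of `NoHeavyLowerTail` — findings of the standing disprover (cdisprove-stmt-CriticalPhenomena-4575)

Crux (route `PercNearOneGluing`, item stmt-CriticalPhenomena-4575, "engine"):
`∀ ε > 0 ∃ δ > 0 ∀ (n, w, A, o)`, `P(o ↔ A) > 1 − δ` (H1) and `∀ a a' ∈ A, P(a ↔ a') > 1 − δ` (H2)
imply `P(1 ≤ N < δ·EN/ε) < ε`, `N = #{a ∈ A : o ↔ a}`, `EN = ∑_{a ∈ A} P(o ↔ a)`,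
`P = prodBernoulli w` on `Set (Sym2 (Fin n))`. Elaborates (rc 0); `openConn` is reflexive, every
event is measurable (`measurableSet_config`), no junk values.

VERDICT SO FAR: NOT REFUTED — and a refutation would settle an open problem, because of (B).

## Findings (all sorry-free, axioms ⊆ {propext, Classical.choice, Quot.sound})

* **B. `of_nearOneGluing : NearOneGluing → NoHeavyLowerTail`.** The "engine" is implied by X
  (Kozma–Nitzan Conjecture 3) by a union bound plus first-moment counting on the own count of a
  fixed `a₀ ∈ A` — no Harris inequality. With the route's glue item 4577 (`NoHeavyLowerTail →
  NearOneGluing`) the crux is EQUIVALENT to X: it is not "strictly stronger", and every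
  counterexample to it is a counterexample to KN Conjecture 3 (arXiv:2401.12397 p.15, open; KN
  could not settle even Conjecture 1 beyond |A| = 2). The threshold `δ·EN/ε` is immaterial: the
  same proof handles any threshold `≤ c·|A|`, `c < 1`.
* **B.2 `noHeavyLowerTailSuffices : NoHeavyLowerTailSuffices`** (the route's glue item 4577, the
  exact decl, proved: Harris + counting) and hence **`iff_nearOneGluing : NoHeavyLowerTail ↔
  NearOneGluing`**, **`iff_KozmaNitzan2024_conjecture3`**: the crux IS Kozma–Nitzan Conjecture 3.
* **B.3 `lowerTail_lt_of_nearOneGluing`.** Under X, for every fixed `c < 1`: `P(1 ≤ N < c·|A|) < ε`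
  — the bimodality `N ∈ {0} ∪ [c|A|, |A|]` w.h.p.; the crux's threshold `δ·EN/ε` is immaterial.
* **C.1 `noHeavyLowerTail_false_without_pairwise : ¬ NoHeavyLowerTailWithoutPairwise`.** H2 is
  load-bearing. Witness family `W_m`: finger `o—a₁` (weight 1), switch `o—a₂` (weight 1/2), hub
  leaves `a₂—a_j` (weight 1, `m` of them), everything else 0; `P(o ↔ A) = 1`, `N = 1` with
  probability `1/2`, `EN ≥ m/2`; at `ε = 1/4`, `m > 1/δ` the bad event has probability `≥ 1/2`.
* **C.2 `withoutReach_of_additiveGluing : AdditiveGluing → NoHeavyLowerTailWithoutReach`** (and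
  `withoutReach_of_KNConjecture1`). H1 is NOT cheaply removable-or-not: the H1-free statement
  follows from the route's own proxy `AdditiveGluing` (item 4576), a fortiori from KN
  Conjecture 1, with the linear rate `δ = ε/16`; so a witness showing H1 necessary would be a
  one-graph refutation of 4576. In the proof of (B), H1 only feeds Conjecture 3's hypothesis.
* **D.1 `linearForm_three_of_additiveGluing : AdditiveGluing → LinearForm 3`** (and
  `…_of_KNConjecture1`), **`of_linearForm : 0 ≤ C → LinearForm C → NoHeavyLowerTail`.** The
  planner's finitely-refutable λ-uniform linear form `P(1 ≤ N < EN/2) ≤ C (P(o ↮ A) + max P(a ↮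
  a'))` is implied by `AdditiveGluing` already with `C = 3` (and without the `P(o ↮ A)` term): an
  exact sweep can only show a ratio `> 3` by refuting 4576 (and KN Conjecture 1); conversely any
  `C` gives the crux. Hierarchy made formal: `of_KNConjecture1 : KNConjecture1 → NoHeavyLowerTail`
  via `additiveGluing_of_KNConjecture1`, `nearOneGluing_of_additiveGluing`.
* **D.2 `not_noHeavyLowerTail_uniform : ¬ NoHeavyLowerTailUniform`.** `∃ δ ∀ ε` is false already
  for `A = {o}` (one vertex): `δ` must depend on `ε`; the statement only speaks about relay sets
  with `EN > ε/δ`.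
* **D.3 `exists_bad_ge`, `not_noHeavyLowerTailRate`.** TIGHTNESS of the rate: for every
  `0 < ε < 1` and every `δ > ε` the rate witness `R_{m,ε}` (chain `o —1— v1 —(1−ε)— v2` plus hub
  leaves) satisfies both hypotheses at level `δ` with `P(Bad) ≥ ε`; so `δ(ε) ≤ ε` is necessary and
  no rate `δ = κε`, `κ > 1`, is possible — against `δ = ε/16` sufficient under 4576 (C.2).
* **E. `bad_empty_of_card_le`.** For `|A| ≤ K` the bad event is EMPTY once `δ ≤ ε/(K+1)`, with no
  hypothesis on the graph: all content is uniformity in `|A|` (so in `n`).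

## Why it resists (heuristic, for ideators)
On the bad event `o` is joined only to "defectors" `D = A ∖ (giant A-cluster)`, `P(a ∈ D) ≤ 2δ`,
and `{o ↔ a}` (increasing) and `{a ∈ D}` (decreasing) are NEGATIVELY correlated (Harris), so
`∑_a P(o ↔ a, a ∈ D) ≤ 2δ·EN`: a counterexample must spread the bad event over `≥ ε/δ` disjoint
events "C(o) ∩ A = {a_i}", i.e. `o` must find the defector without touching the giant. Every
gadget tried by hand (stars, hubs, corridors with rungs, Erdős–Rényi relay cliques, block
defectors, tentative `o`) gives `P(Bad) = O(δ)` by the first-open-finger argument: when the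
exploration from `o` first meets `a* ∈ A`, the lifelines of `a*` to the rest of `A` not yet
explored are closed only with conditional probability `O(δ)` unless they run back through the
explored region. In print this class is closed off for Conjecture 1 itself: KN Theorem 4 (p. 12)
— if `o` is isolated in `G ∖ A` (all neighbours of `o` lie in `A`) then `(G, A, o, b)` is "good",
i.e. satisfies even the pre-FKG Conjecture 2 — and Theorem 5 (p. 13: `o` adjacent to `A` and to one
extra `x` itself adjacent only to `A ∪ {o}`); by `of_KNConjecture1`-style bookkeeping restricted to
such graphs, every "star-attached `o`" gadget satisfies the crux with a LINEAR rate, whatever the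
relay structure behind `A`. A counterexample therefore needs `o` at graph distance ≥ 2 from `A`
through a genuinely two-layer buffer. The same obstruction in miniature ("no reliable selector"):
a gadget in which, with probability `≥ 1 − δ`, EXACTLY ONE of many terminals is joined to the input,
the choice being non-degenerate, does not exist — if terminal `T₁` is reached through an edge `e₁`
then, `e₁` being independent of (or only helpful to) the other terminals' routes, `P(no other
terminal)` is the same whether or not `T₁` is reached, so either two terminals or none are reached
with probability bounded below; among many individually-unreliable terminals the number reached is
Poisson-like and `P(exactly one) ≤ 1/e + o(1)`. Every would-be counterexample to the crux contains
such a selector (the bad event selects which defector `o` holds). The only remaining cheap target is a certified small-graph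
violation of `AdditiveGluing` / KN Conjecture 1 (ratio > 3 in D.1), which KN's numerics and the
planner's sweeps (n ≤ 7 exhaustive at few weight levels) did not find; j005581 extends this to
continuous weights on n ≤ 9 by hill-climbing.

## Computations (kit; job ids, results land in the disprover's folder `~/compute/<id>/`)
* j005274 — cancelled (16 cores would not schedule behind a 2400-job queue); resubmitted as
* j005581 — cancelled after 6 h in the queue (prio 79–85 behind ~1200–2400 jobs); the cdisprove
  lane is clamped to 4 cores / 0.5 h, so resubmitted 2026-08-16T04:50Z as
* j013226 (1 core, seed 17) and j013227 (4 cores, seed 23), 22.5 min of search each —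
  `knsearch/kn_search.py`: exact connectivity-partition DP (Bell(n) states) on `K_n`, `n ≤ 8`,
  arbitrary weights (zero weight = absent edge), float hill-climbing with random restarts and exact
  rational re-verification, maximising (R1) the KN-Conjecture-1 ratio `P(o↔A)·min_a P(a↔b)/P(o↔b)`
  (violation iff > 1), (S2) the `AdditiveGluing` slack (violation iff > 0), (R3) the linear-form
  ratio `P(1 ≤ N < EN/2)/(P(o↮A) + max P(a↮a'))` (by D.1 a value > 3 refutes 4576 and KN
  Conjecture 1; the planner observed ≤ 1). Their `summary.json` (+ sha256 manifest) is auto-attached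
  to item 4575 as evidence when they end; results also land in `~/compute/<id>/outputs/`.
  Local smoke run (n ≤ 5, 20 s): R1 = 1 exactly (degenerate gluing `o ≡ a`), S2 = 0, R3 = 0.

## Literature (negative results in print?)
KN arXiv:2401.12397 re-read pp. 3, 15, 32–37: Conjecture 3 typed verbatim (no exclusion of
`o, b ∈ A`; KN themselves note WLOG `b ∈ A` for Conj. 2, p. 3); §5.7's only counterexamples are to
the DIRECTED analogue (Fig. 4: 7/16 < 15/32) and to the one-edge inductive step (Thm 13); §5.5:
"numerical evidence points towards yes" for all candidate strengthenings. arXiv search 2024–26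
(Gladkov arXiv:2408.08457, Gladkov–Zimin arXiv:2404.08873, Ayyer–Linusson–Ravichandran
arXiv:2509.18788 bunkbed/RCM) — no refutation or proof of Conj. 1/3 found; arXiv author/title
queries 2026-08-16 ("Nitzan percolation", "Kozma percolation critical", "Engelenburg percolation",
"Gladkov Zimin", "post-FKG", "conditional correlation inequalities percolation", "bunkbed
conjecture") show no follow-up to KN 2024 through 2026-08; zbMATH lists only the preprint; searchd /
S2 / OpenAlex / galaxy were degraded (rc 75 / HTTP 429 / daily budget / queue timeouts) —
`search-degraded` for the citation graph, to be re-run; the planner's and route reviewer's searches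
of 2026-08-15 were also null.

## The bad event in (W, ρ)-form — the sharpest statement of the obstruction (cycle 2, for the lead)
Condition on the `A`-free cluster `C* = W` of `o` (`o ∉ A`; the afree decomposition used by the
picked line). Given `{C* = W}`, the entrances (edges `W → a`, aggregated: `x_a^W = 1 − ∏(1 − w_e)`)
are independent coins, independent of the relay configuration `ρ` on `G − W`; `o ↔ A` iff some
entrance is open, so `u_W := ∏_a (1 − x_a^W) = P(o ↮ A | C* = W)` and `E_W[u_W] = P(o ↮ A) ≤ δ`
(H1). With `S_W(ρ) := {a ∈ A : a ↮ a₀ in G − W under ρ}` (`a₀ ∉ S_W(ρ)`), the bad event at hub `a₀`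
satisfies `Bad ∩ {o ↮ a₀} ∩ {C* = W} ⊆ {E ≠ ∅, E ⊆ S_W(ρ)}` (`E` = entered relay points), whence
exactly
  `P(o ↔ A, o ↮ a₀) ≤ Σ_W P(C* = W) · ( E_ρ[ ∏_{a ∉ S_W(ρ)} (1 − x_a^W) ] − u_W )`.
So a counterexample needs, with probability `≳ ε` over INDEPENDENT `(W, ρ)`, that the sealed set
`S_W(ρ)` swallows all but `O(1)` of the entrance weight `Σ_a −log(1 − x_a^W)` (which is `≥ log(1/δ)`
for typical `W` by H1), although each single `a` is sealed with probability `≤ δ` in `G` (H2) and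
sealing in `G − W` exceeds sealing in `G` only through lifelines via `W`, i.e. via entrances at
hub-connected points, each of which contributes its own factor `(1 − x_b^W) ≤ δ`-ish to the product.
Heavy entrance weight on ONE block behind one bottleneck gives `≈ δ`; weight spread over several
independently-sealing blocks gives `δ^{#blocks}`; making `W` itself select the block is the selector
problem again (disjoint `A`-free corridors percolate independently ⇒ Poisson). A PROOF of the residual
`stub_manyFingersLargePocket` amounts to bounding `E_W E_ρ[u_W^{1−θ_W(ρ)}]`, `θ_W(ρ)` = sealed
fraction of the entrance weight, by `E_W[u_W] + o(1)`.

## Toolkit (A)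
`measurableSet_config`, `mul_measureReal_le_sum_inter` (first-moment counting:
`c·μ(S) ≤ ∑_k μ(S ∩ E_k)` if every point of `S` lies in `≥ c` of the `E_k`),
`card_filter_eq_sum_indicator`, `mem_of_reachable_of_closed`, `ownCount_lowerTail_le`,
`reach_sdiff_le_of_additiveGluing` / `…_of_KNConjecture1`, `additiveGluing_of_KNConjecture1`.
-/

namespace Summit.CriticalPhenomena.PercolationContinuityZ3.Cruxes.NoHeavyLowerTail.Disproof

open MeasureTheory Literature.Probability.LatticeModels Literature.Probability.Percolation
open Summit.CriticalPhenomena.PercolationContinuityZ3.Theses.PercNearOneGluing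

/-! ## A. Toolkit -/

/-- Every event of bond configurations on `Fin n` is measurable (the configuration space
`Set (Sym2 (Fin n))` is finite with measurable singletons). [folklore] -/
theorem measurableSet_config {n : ℕ} (S : Set (Set (Sym2 (Fin n)))) : MeasurableSet S :=
  S.toFinite.measurableSet

/-- **First-moment counting (finite Markov inequality without integrals in the statement).**
If every point of `S` lies in at least `c` of the events `E k`, `k ∈ s`, then
`c · μ(S) ≤ ∑_{k ∈ s} μ(S ∩ E k)`. [folklore] -/
theorem mul_measureReal_le_sum_inter {α κ : Type*} [MeasurableSpace α] (μ : Measure α)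
    [IsFiniteMeasure μ] (s : Finset κ) (E : κ → Set α) (hE : ∀ k ∈ s, MeasurableSet (E k))
    {S : Set α} (hS : MeasurableSet S) (c : ℝ)
    (hc : ∀ ω ∈ S, c ≤ ∑ k ∈ s, (E k).indicator (fun _ => (1 : ℝ)) ω) :
    c * μ.real S ≤ ∑ k ∈ s, μ.real (S ∩ E k) := by
  have hint : ∀ k ∈ s, Integrable ((S ∩ E k).indicator fun _ => (1 : ℝ)) μ :=
    fun k hk => (integrable_const (1 : ℝ)).indicator (hS.inter (hE k hk))
  have h1 : ∀ k ∈ s, μ.real (S ∩ E k) = ∫ ω, (S ∩ E k).indicator (fun _ => (1 : ℝ)) ω ∂μ := by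
    intro k hk
    rw [integral_indicator_const _ (hS.inter (hE k hk)), smul_eq_mul, mul_one]
  have h2 : c * μ.real S = ∫ ω, S.indicator (fun _ => c) ω ∂μ := by
    rw [integral_indicator_const _ hS, smul_eq_mul, mul_comm]
  rw [h2, Finset.sum_congr rfl h1, ← integral_finsetSum s hint]
  refine integral_mono ((integrable_const c).indicator hS) (integrable_finsetSum s hint) ?_
  intro ω
  by_cases hω : ω ∈ S
  · simp only [Set.indicator_of_mem hω]
    refine le_trans (hc ω hω) (le_of_eq (Finset.sum_congr rfl fun k _ => ?_))
    by_cases hk : ω ∈ E k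
    · rw [Set.indicator_of_mem hk, Set.indicator_of_mem (Set.mem_inter hω hk)]
    · rw [Set.indicator_of_notMem hk, Set.indicator_of_notMem (fun h => hk h.2)]
  · simp only [Set.indicator_of_notMem hω]
    exact Finset.sum_nonneg fun k _ => Set.indicator_nonneg (fun _ _ => zero_le_one) _

/-- Counting form: the number of events containing `ω`, as a real number, is the sum of the
indicators. [folklore] -/
theorem card_filter_eq_sum_indicator {α κ : Type*} (s : Finset κ) (E : κ → Set α) (ω : α)
    [DecidablePred fun k => ω ∈ E k] :
    ((s.filter fun k => ω ∈ E k).card : ℝ) = ∑ k ∈ s, (E k).indicator (fun _ => (1 : ℝ)) ω := by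
  rw [Finset.natCast_card_filter]
  refine Finset.sum_congr rfl fun k _ => ?_
  by_cases hk : ω ∈ E k
  · rw [if_pos hk, Set.indicator_of_mem hk]
  · rw [if_neg hk, Set.indicator_of_notMem hk]

open scoped Classical in
/-- **Counting bound for the own count of a reliable relay point.** If `P(a₀ ↮ a) ≤ η` for all
`a ∈ A` then `(|A| − τ) · P(#{a ∈ A : a₀ ↔ a} < τ) ≤ |A| · η`. [folklore] -/
theorem ownCount_lowerTail_le {n : ℕ} (w : Sym2 (Fin n) → unitInterval) (A : Finset (Fin n))
    (a₀ : Fin n) (η τ : ℝ)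
    (hη : ∀ a ∈ A, (prodBernoulli w).real (openConn a₀ a)ᶜ ≤ η) :
    ((A.card : ℝ) - τ) * (prodBernoulli w).real
        {ω | ((A.filter fun a => ω ∈ openConn a₀ a).card : ℝ) < τ} ≤ A.card * η := by
  classical
  set P := prodBernoulli w with hP
  calc ((A.card : ℝ) - τ) * P.real {ω | ((A.filter fun a => ω ∈ openConn a₀ a).card : ℝ) < τ}
      ≤ ∑ a ∈ A, P.real ({ω | ((A.filter fun a => ω ∈ openConn a₀ a).card : ℝ) < τ} ∩
          (openConn a₀ a)ᶜ) := by
        refine mul_measureReal_le_sum_inter P A (fun a => (openConn a₀ a)ᶜ)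
          (fun a _ => measurableSet_config _) (measurableSet_config _) _ fun ω hω => ?_
        rw [← card_filter_eq_sum_indicator]
        have hsplit := Finset.card_filter_add_card_filter_not (s := A) (fun a => ω ∈ openConn a₀ a)
        have hω' : ((A.filter fun a => ω ∈ openConn a₀ a).card : ℝ) < τ := hω
        have hcast : ((A.filter fun a => ω ∈ openConn a₀ a).card : ℝ)
            + ((A.filter fun a => ¬ ω ∈ openConn a₀ a).card : ℝ) = A.card := by
          exact_mod_cast hsplit
        have : ((A.filter fun a => ω ∈ (openConn a₀ a)ᶜ).card : ℝ)
            = ((A.filter fun a => ¬ ω ∈ openConn a₀ a).card : ℝ) := rfl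
        linarith
    _ ≤ ∑ a ∈ A, P.real (openConn a₀ a)ᶜ :=
        Finset.sum_le_sum fun a _ => measureReal_mono Set.inter_subset_right
    _ ≤ ∑ a ∈ A, η := Finset.sum_le_sum fun a ha => hη a ha
    _ = A.card * η := by simp


/-! ## B. The crux is X in disguise: `NearOneGluing → NoHeavyLowerTail` -/

/-- **`NoHeavyLowerTail` follows from `NearOneGluing` (Kozma–Nitzan Conjecture 3) by a union bound
and first-moment counting — no Harris inequality needed.** Together with the route's glue
`NoHeavyLowerTailSuffices` (item 4577: `NoHeavyLowerTail → NearOneGluing`, Harris + Markov) the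
"engine" crux is EQUIVALENT to X; it is not strictly stronger, and refuting it means refuting
KN Conjecture 3 (arXiv:2401.12397 p.15, open).
Proof: fix `a₀ ∈ A`. On `{o ↔ a₀}` the cluster of `o` is the cluster of `a₀`, so
`N = N_{a₀} := #{a' ∈ A : a₀ ↔ a'}` and `{N < t} ⊆ {N_{a₀} < t}`; counting gives
`(M − t)·P(N_{a₀} < t) ≤ ∑_{a'} P(a₀ ↮ a') < M δ` (`M = |A|`, `t = δ·EN/ε ≤ M/16` for `δ ≤ ε/16`),
so `P(N_{a₀} < t) < 16δ/15`. On `{o ↮ a₀}`: `P(o ↮ a₀) < ε/4` by `NearOneGluing` at `ε/4` with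
`b := a₀` (its hypotheses are exactly ours). Total `< ε/4 + ε/15 < ε`. [folklore] -/
theorem of_nearOneGluing (hX : NearOneGluing) : NoHeavyLowerTail := by
  classical
  intro ε hε
  obtain ⟨δ₃, hδ₃, h3⟩ := hX (ε / 4) (by positivity)
  refine ⟨min δ₃ (ε / 16), lt_min hδ₃ (by positivity), ?_⟩
  intro n w A o hA hpair
  set δ := min δ₃ (ε / 16) with hδdef
  have hδ₃' : δ ≤ δ₃ := min_le_left _ _
  have hδε : δ ≤ ε / 16 := min_le_right _ _
  set P := prodBernoulli w with hP
  -- trivial when `1 < ε`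
  by_cases hε1 : 1 < ε
  · exact lt_of_le_of_lt measureReal_le_one hε1
  push Not at hε1
  -- `A` is nonempty (else hypothesis 1 reads `1 - δ < 0`)
  have hAne : A.Nonempty := by
    rw [Finset.nonempty_iff_ne_empty]
    rintro rfl
    simp at hA
    linarith
  obtain ⟨a₀, ha₀⟩ := hAne
  -- Conjecture 3 with `b := a₀`
  have hoa₀ : 1 - ε / 4 < P.real (openConn o a₀) :=
    h3 n w A o a₀ (lt_of_le_of_lt (by linarith) hA)
      (fun a ha => lt_of_le_of_lt (by linarith) (hpair a ha a₀ ha₀))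
  -- sizes
  set M : ℕ := A.card with hM
  set EN : ℝ := ∑ a ∈ A, P.real (openConn o a) with hEN
  have hENle : EN ≤ M := by
    calc EN ≤ ∑ a ∈ A, (1 : ℝ) := Finset.sum_le_sum fun a _ => measureReal_le_one
      _ = M := by simp [hM]
  have hENnn : 0 ≤ EN := Finset.sum_nonneg fun a _ => measureReal_nonneg
  have hMpos : (1 : ℝ) ≤ M := by exact_mod_cast Finset.card_pos.2 ⟨a₀, ha₀⟩
  set t : ℝ := δ * EN / ε with ht
  have htM : t ≤ M / 16 := by
    rw [ht, div_le_div_iff₀ hε (by norm_num : (0:ℝ) < 16)]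
    have : δ * EN ≤ ε / 16 * M :=
      mul_le_mul hδε hENle hENnn (by positivity)
    nlinarith
  -- the lower-tail event of `a₀`'s own count
  let S₁ : Set (Set (Sym2 (Fin n))) := {ω | ((A.filter fun a => ω ∈ openConn a₀ a).card : ℝ) < t}
  -- counting: `(M - t) P(S₁) ≤ ∑_{a'} P(S₁ ∩ {a₀ ↮ a'})`
  have hcount : (M - t) * P.real S₁ ≤ ∑ a ∈ A, P.real (S₁ ∩ (openConn a₀ a)ᶜ) := by
    refine mul_measureReal_le_sum_inter P A (fun a => (openConn a₀ a)ᶜ)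
      (fun a _ => measurableSet_config _) (measurableSet_config _) _ fun ω hω => ?_
    rw [← card_filter_eq_sum_indicator]
    have hsplit := Finset.card_filter_add_card_filter_not (s := A) (fun a => ω ∈ openConn a₀ a)
    have hω' : ((A.filter fun a => ω ∈ openConn a₀ a).card : ℝ) < t := hω
    have hcast : ((A.filter fun a => ω ∈ openConn a₀ a).card : ℝ)
        + ((A.filter fun a => ¬ ω ∈ openConn a₀ a).card : ℝ) = M := by
      rw [hM]; exact_mod_cast hsplit
    have : ((A.filter fun a => ω ∈ (openConn a₀ a)ᶜ).card : ℝ)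
        = ((A.filter fun a => ¬ ω ∈ openConn a₀ a).card : ℝ) := by
      rfl
    linarith
  -- each summand is `< δ`
  have hsum : ∑ a ∈ A, P.real (S₁ ∩ (openConn a₀ a)ᶜ) < M * δ := by
    calc ∑ a ∈ A, P.real (S₁ ∩ (openConn a₀ a)ᶜ)
        ≤ ∑ a ∈ A, P.real ((openConn a₀ a)ᶜ) :=
          Finset.sum_le_sum fun a _ => measureReal_mono Set.inter_subset_right
      _ < ∑ a ∈ A, δ := by
          refine Finset.sum_lt_sum_of_nonempty ⟨a₀, ha₀⟩ fun a ha => ?_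
          rw [probReal_compl_eq_one_sub (measurableSet_config _)]
          linarith [hpair a₀ ha₀ a ha]
      _ = M * δ := by simp [hM]
  have hS₁ : P.real S₁ < 16 * δ / 15 := by
    have h15 : (15 : ℝ) * M / 16 ≤ M - t := by linarith
    have hlt : (M : ℝ) * (15 / 16 * P.real S₁) < M * δ := by
      calc (M : ℝ) * (15 / 16 * P.real S₁) = 15 * M / 16 * P.real S₁ := by ring
        _ ≤ (M - t) * P.real S₁ := mul_le_mul_of_nonneg_right h15 measureReal_nonneg
        _ < M * δ := lt_of_le_of_lt hcount hsum
    have := lt_of_mul_lt_mul_left hlt (by positivity)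
    linarith
  -- assemble: Bad ⊆ {o ↮ a₀} ∪ S₁
  refine lt_of_le_of_lt (measureReal_mono (s₂ := (openConn o a₀)ᶜ ∪ S₁) ?_) ?_
  · intro ω hω
    simp only [Set.mem_setOf_eq] at hω
    obtain ⟨-, h2⟩ := hω
    by_cases ho : ω ∈ openConn o a₀
    · right
      have hfc : (A.filter fun a => ω ∈ openConn o a) = (A.filter fun a => ω ∈ openConn a₀ a) := by
        refine Finset.filter_congr fun a _ => ?_
        simp only [openConn, Set.mem_setOf_eq] at ho ⊢
        exact ⟨fun h => ho.symm.trans h, fun h => ho.trans h⟩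
      show ((A.filter fun a => ω ∈ openConn a₀ a).card : ℝ) < t
      rw [← hfc]
      exact h2
    · exact Or.inl ho
  · calc P.real ((openConn o a₀)ᶜ ∪ S₁) ≤ P.real (openConn o a₀)ᶜ + P.real S₁ :=
          measureReal_union_le _ _
      _ < ε / 4 + 16 * δ / 15 := by
          refine add_lt_add ?_ hS₁
          rw [probReal_compl_eq_one_sub (measurableSet_config _)]
          linarith
      _ ≤ ε := by linarith


/-! ### B.2 The converse glue (route item 4577, `NoHeavyLowerTailSuffices`) — proved here too, so
that the equivalence `NoHeavyLowerTail ↔ NearOneGluing` is fully formal -/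

/-- **The route's glue `NoHeavyLowerTailSuffices` (item stmt-CriticalPhenomena-4577), proved**:
`NoHeavyLowerTail → NearOneGluing`. Planner's argument: `δ₀` from the engine at `ε/3`,
`δ = min (δ₀/2) (ε/3)`; pairwise reliability of `A` from `P(a ↔ a') ≥ P(a ↔ b) P(a' ↔ b)`
(Harris); then `{o ↮ b} ⊆ {o ↮ A} ∪ {1 ≤ N < t} ∪ {N ≥ t, o ↮ b}` with `t = 3δ₀·EN/ε`, and
`t · P(N ≥ t, o ↮ b) ≤ ∑_a P(o ↔ a, a ↮ b) ≤ δ · EN` (counting + Harris increasing × decreasing),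
so `P(o ↮ b) < δ + ε/3 + ε/6 ≤ 5ε/6`. (Candidate proof for the prover of 4577; a refuter cannot
land it.) [folklore] -/
theorem noHeavyLowerTailSuffices : NoHeavyLowerTailSuffices := by
  classical
  intro hN ε hε
  obtain ⟨δ₀, hδ₀, h0⟩ := hN (ε / 3) (by positivity)
  refine ⟨min (δ₀ / 2) (ε / 3), lt_min (by positivity) (by positivity), ?_⟩
  intro n w A o b hA hb
  set δ := min (δ₀ / 2) (ε / 3) with hδdef
  have hδ₀' : δ ≤ δ₀ / 2 := min_le_left _ _
  have hδε : δ ≤ ε / 3 := min_le_right _ _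
  have hδpos : 0 < δ := lt_min (by positivity) (by positivity)
  set P := prodBernoulli w with hP
  by_cases hε1 : 1 < ε
  · exact lt_of_lt_of_le (by linarith) measureReal_nonneg
  push Not at hε1
  have hδ1 : δ ≤ 1 / 3 := by linarith
  -- pairwise reliability of `A` (Harris, increasing × increasing)
  have hpair : ∀ a ∈ A, ∀ a' ∈ A, 1 - δ₀ < P.real (openConn a a') := by
    intro a ha a' ha'
    have h1 := hb a ha
    have h2 := hb a' ha'
    have hH := prodBernoulli_harris w (isUpperSet_openConn a b) (isUpperSet_openConn a' b)
      (measurableSet_config _) (measurableSet_config _)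
    have hsub : openConn a b ∩ openConn a' b ⊆ (openConn a a' : Set (Set (Sym2 (Fin n)))) := by
      rintro ω ⟨h1, h2⟩
      simp only [openConn, Set.mem_setOf_eq] at h1 h2 ⊢
      exact h1.trans h2.symm
    have hmono : P.real (openConn a b ∩ openConn a' b) ≤ P.real (openConn a a') :=
      measureReal_mono hsub (measure_ne_top _ _)
    have hprod : (1 - δ) * (1 - δ) ≤ P.real (openConn a b) * P.real (openConn a' b) :=
      mul_le_mul h1.le h2.le (by linarith) measureReal_nonneg
    rw [hP] at hmono h1 h2 hprod
    nlinarith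
  have hA' : 1 - δ₀ < P.real (⋃ a ∈ A, openConn o a) := by linarith
  have hlow := h0 n w A o hA' hpair
  -- the mean and the threshold
  set EN : ℝ := ∑ a ∈ A, P.real (openConn o a) with hEN
  have hUle : P.real (⋃ a ∈ A, openConn o a) ≤ EN := measureReal_biUnion_finset_le A _
  have hENpos : 0 < EN := by linarith
  set t : ℝ := δ₀ * EN / (ε / 3) with ht
  have htpos : 0 < t := by positivity
  -- the upper part `S = {N ≥ t, o ↮ b}`
  let S : Set (Set (Sym2 (Fin n))) :=
    {ω | t ≤ ((A.filter fun a => ω ∈ openConn o a).card : ℝ) ∧ ω ∉ openConn o b}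
  have hcount : t * P.real S ≤ ∑ a ∈ A, P.real (S ∩ openConn o a) := by
    refine mul_measureReal_le_sum_inter P A (fun a => openConn o a)
      (fun a _ => measurableSet_config _) (measurableSet_config _) _ fun ω hω => ?_
    rw [← card_filter_eq_sum_indicator]
    exact hω.1
  have hterm : ∀ a ∈ A, P.real (S ∩ openConn o a) ≤ P.real (openConn o a) * δ := by
    intro a ha
    have hsub : S ∩ openConn o a ⊆ openConn o a ∩ (openConn a b)ᶜ := by
      rintro ω ⟨⟨-, hob⟩, hoa⟩
      refine ⟨hoa, fun hab => hob ?_⟩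
      simp only [openConn, Set.mem_setOf_eq] at hoa hab ⊢
      exact hoa.trans hab
    have hH := prodBernoulli_harris_upper_lower w (isUpperSet_openConn o a)
      (isUpperSet_openConn a b).compl (measurableSet_config _) (measurableSet_config _)
    have hc : P.real (openConn a b)ᶜ ≤ δ := by
      rw [probReal_compl_eq_one_sub (measurableSet_config _)]
      linarith [hb a ha]
    calc P.real (S ∩ openConn o a) ≤ P.real (openConn o a ∩ (openConn a b)ᶜ) :=
          measureReal_mono hsub (measure_ne_top _ _)
      _ ≤ P.real (openConn o a) * P.real (openConn a b)ᶜ := hH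
      _ ≤ P.real (openConn o a) * δ := mul_le_mul_of_nonneg_left hc measureReal_nonneg
  have hS : P.real S ≤ ε / 6 := by
    have h1 : t * P.real S ≤ EN * δ := by
      refine le_trans hcount (le_trans (Finset.sum_le_sum hterm) (le_of_eq ?_))
      rw [← Finset.sum_mul]
    -- `P(S) ≤ EN δ / t = δ (ε/3) / δ₀ ≤ ε/6`
    have h2 : P.real S ≤ EN * δ / t := by
      rw [le_div_iff₀ htpos]; linarith
    refine le_trans h2 ?_
    rw [ht, div_div_eq_mul_div, div_le_iff₀ (by positivity)]
    have : EN * δ * (ε / 3) ≤ EN * (δ₀ / 2) * (ε / 3) := by gcongr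
    nlinarith
  -- decomposition of `{o ↮ b}`
  have hdec : (openConn o b)ᶜ ⊆ ((⋃ a ∈ A, openConn o a)ᶜ ∪
      {ω | 1 ≤ (A.filter fun a => ω ∈ openConn o a).card ∧
        ((A.filter fun a => ω ∈ openConn o a).card : ℝ) < δ₀ * EN / (ε / 3)}) ∪ S := by
    intro ω hω
    by_cases hN0 : (A.filter fun a => ω ∈ openConn o a).card = 0
    · left; left
      intro hU
      simp only [Set.mem_iUnion, exists_prop] at hU
      obtain ⟨a, ha, hoa⟩ := hU
      have : a ∈ A.filter fun a => ω ∈ openConn o a := Finset.mem_filter.2 ⟨ha, hoa⟩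
      rw [Finset.card_eq_zero] at hN0
      rw [hN0] at this
      simp at this
    · by_cases hlt : ((A.filter fun a => ω ∈ openConn o a).card : ℝ) < δ₀ * EN / (ε / 3)
      · left; right
        exact ⟨Nat.pos_of_ne_zero hN0, hlt⟩
      · right
        exact ⟨le_of_not_gt hlt, hω⟩
  have hfin : P.real (openConn o b)ᶜ < ε := by
    calc P.real (openConn o b)ᶜ
        ≤ P.real (((⋃ a ∈ A, openConn o a)ᶜ ∪
            {ω | 1 ≤ (A.filter fun a => ω ∈ openConn o a).card ∧
              ((A.filter fun a => ω ∈ openConn o a).card : ℝ) < δ₀ * EN / (ε / 3)}) ∪ S) :=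
          measureReal_mono hdec (measure_ne_top _ _)
      _ ≤ (P.real (⋃ a ∈ A, openConn o a)ᶜ +
            P.real {ω | 1 ≤ (A.filter fun a => ω ∈ openConn o a).card ∧
              ((A.filter fun a => ω ∈ openConn o a).card : ℝ) < δ₀ * EN / (ε / 3)}) + P.real S :=
          le_trans (measureReal_union_le _ _) (add_le_add (measureReal_union_le _ _) le_rfl)
      _ < (δ + ε / 3) + ε / 6 := by
          refine add_lt_add_of_lt_of_le (add_lt_add ?_ hlow) hS
          rw [probReal_compl_eq_one_sub (measurableSet_config _)]
          linarith
      _ ≤ ε := by linarith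
  rw [probReal_compl_eq_one_sub (measurableSet_config _)] at hfin
  linarith

/-- **The crux is equivalent to X.** [folklore] -/
theorem iff_nearOneGluing : NoHeavyLowerTail ↔ NearOneGluing :=
  ⟨noHeavyLowerTailSuffices, of_nearOneGluing⟩

/-- In Literature terms: the crux is Kozma–Nitzan's Conjecture 3 (`Iff.rfl` with `NearOneGluing`). -/
theorem iff_KozmaNitzan2024_conjecture3 :
    NoHeavyLowerTail ↔ Literature.Probability.Percolation.KozmaNitzan2024_conjecture3 :=
  iff_nearOneGluing

/-! ### B.3 The bimodality form: under X, `N ∈ {0} ∪ [c|A|, |A|]` with high probability, for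
every fixed `c < 1` — the threshold `δ·EN/ε` of the crux is immaterial -/

open scoped Classical in
/-- **Lower tail up to any fixed fraction of `|A|`.** From `NearOneGluing`: for every `c < 1` and
`ε > 0` there is `δ > 0` such that the hypotheses of the crux give `P(1 ≤ N < c·|A|) < ε`
(`δ = min δ₃(ε/2) ((1−c)ε/4) (ε/4)`; counting gives `P(N_{a₀} < c|A|) ≤ δ/(1−c)`). [folklore] -/
theorem lowerTail_lt_of_nearOneGluing (hX : NearOneGluing) {c : ℝ} (hc : c < 1) {ε : ℝ}
    (hε : 0 < ε) :
    ∃ δ : ℝ, 0 < δ ∧ ∀ (n : ℕ) (w : Sym2 (Fin n) → unitInterval) (A : Finset (Fin n)) (o : Fin n),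
      1 - δ < (prodBernoulli w).real (⋃ a ∈ A, openConn o a) →
        (∀ a ∈ A, ∀ a' ∈ A, 1 - δ < (prodBernoulli w).real (openConn a a')) →
          (prodBernoulli w).real {ω | 1 ≤ (A.filter fun a => ω ∈ openConn o a).card ∧
            ((A.filter fun a => ω ∈ openConn o a).card : ℝ) < c * A.card} < ε := by
  classical
  obtain ⟨δ₃, hδ₃, h3⟩ := hX (ε / 2) (by positivity)
  have h1c : 0 < 1 - c := by linarith
  refine ⟨min δ₃ (min ((1 - c) * ε / 4) (ε / 4)), lt_min hδ₃ (lt_min (by positivity) (by positivity)), ?_⟩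
  intro n w A o hA hpair
  set δ := min δ₃ (min ((1 - c) * ε / 4) (ε / 4)) with hδdef
  have hδ₃' : δ ≤ δ₃ := min_le_left _ _
  have hδc : δ ≤ (1 - c) * ε / 4 := le_trans (min_le_right _ _) (min_le_left _ _)
  have hδε : δ ≤ ε / 4 := le_trans (min_le_right _ _) (min_le_right _ _)
  set P := prodBernoulli w with hP
  by_cases hε1 : 1 < ε
  · exact lt_of_le_of_lt measureReal_le_one hε1
  push Not at hε1
  have hAne : A.Nonempty := by
    rw [Finset.nonempty_iff_ne_empty]
    rintro rfl
    simp at hA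
    linarith
  obtain ⟨a₀, ha₀⟩ := hAne
  have hoa₀ : 1 - ε / 2 < P.real (openConn o a₀) :=
    h3 n w A o a₀ (lt_of_le_of_lt (by linarith) hA)
      (fun a ha => lt_of_le_of_lt (by linarith) (hpair a ha a₀ ha₀))
  set M : ℕ := A.card with hM
  have hMpos : (0 : ℝ) < M := by exact_mod_cast Finset.card_pos.2 ⟨a₀, ha₀⟩
  let S₁ : Set (Set (Sym2 (Fin n))) :=
    {ω | ((A.filter fun a => ω ∈ openConn a₀ a).card : ℝ) < c * M}
  have hcount : ((M : ℝ) - c * M) * P.real S₁ ≤ M * δ := by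
    refine ownCount_lowerTail_le w A a₀ δ (c * M) (fun a ha => ?_)
    rw [probReal_compl_eq_one_sub (measurableSet_config _)]
    linarith [hpair a₀ ha₀ a ha]
  have hS₁ : P.real S₁ ≤ δ / (1 - c) := by
    rw [le_div_iff₀ h1c]
    have : (M : ℝ) * (P.real S₁ * (1 - c)) ≤ M * δ := by nlinarith
    exact le_of_mul_le_mul_left this hMpos
  have hS₁' : P.real S₁ < ε / 2 := by
    refine lt_of_le_of_lt hS₁ ?_
    rw [div_lt_iff₀ h1c]; nlinarith
  refine lt_of_le_of_lt (measureReal_mono (s₂ := (openConn o a₀)ᶜ ∪ S₁) ?_ (measure_ne_top _ _)) ?_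
  · intro ω hω
    simp only [Set.mem_setOf_eq] at hω
    obtain ⟨-, h2⟩ := hω
    by_cases ho : ω ∈ openConn o a₀
    · right
      have hfc : (A.filter fun a => ω ∈ openConn o a) = (A.filter fun a => ω ∈ openConn a₀ a) := by
        refine Finset.filter_congr fun a _ => ?_
        simp only [openConn, Set.mem_setOf_eq] at ho ⊢
        exact ⟨fun h => ho.symm.trans h, fun h => ho.trans h⟩
      show ((A.filter fun a => ω ∈ openConn a₀ a).card : ℝ) < c * M
      rw [← hfc]
      exact h2
    · exact Or.inl ho
  · calc P.real ((openConn o a₀)ᶜ ∪ S₁) ≤ P.real (openConn o a₀)ᶜ + P.real S₁ :=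
          measureReal_union_le _ _
      _ < ε / 2 + ε / 2 := by
          refine add_lt_add ?_ hS₁'
          rw [probReal_compl_eq_one_sub (measurableSet_config _)]
          linarith
      _ = ε := by ring

/-! ## C. Load-bearing hypotheses

### C.1 Pairwise reliability of `A` (hypothesis 2) cannot be dropped -/

open scoped Classical in
/-- The crux with hypothesis 2 (`∀ a a' ∈ A, P(a ↔ a') > 1 − δ`) deleted. -/
def NoHeavyLowerTailWithoutPairwise : Prop :=
  ∀ ε : ℝ, 0 < ε → ∃ δ : ℝ, 0 < δ ∧ ∀ (n : ℕ) (w : Sym2 (Fin n) → unitInterval)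
    (A : Finset (Fin n)) (o : Fin n),
    1 - δ < (prodBernoulli w).real (⋃ a ∈ A, openConn o a) →
      (prodBernoulli w).real {ω | 1 ≤ (A.filter fun a => ω ∈ openConn o a).card ∧
        ((A.filter fun a => ω ∈ openConn o a).card : ℝ) <
          δ * (∑ a ∈ A, (prodBernoulli w).real (openConn o a)) / ε} < ε

/-- A reachability lemma: a set of vertices closed under adjacency contains the cluster of each
of its points. [folklore] -/
theorem mem_of_reachable_of_closed {V : Type*} {G : SimpleGraph V} {T : Set V}
    (hT : ∀ x y, x ∈ T → G.Adj x y → y ∈ T) {x y : V} (h : G.Reachable x y) (hx : x ∈ T) :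
    y ∈ T := by
  obtain ⟨p⟩ := h
  induction p with
  | nil => exact hx
  | cons hadj _ ih => exact ih (hT _ _ hx hadj)

section Witness

/-! The witness family `W_m` (m ≥ 1/δ): vertices `Fin (m+3)`, `o = v0`, `A = univ \ {o}`;
weights `w(v0 v1) = 1` (a private finger), `w(v0 v2) = 1/2` (the switch), `w(v2 j) = 1` for the
`m` hub leaves `j ≥ 3`, all other pairs `0`. Then `P(o ↔ A) = 1`, `N = 1` with probability `1/2`
(switch closed) and `N = m + 2` otherwise, `EN ≥ m/2`, so `P(1 ≤ N < δ·EN/ε) ≥ 1/2` at `ε = 1/4`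
once `δ m > 1`: the lower tail IS heavy when the relay set is not pairwise reliable
(`P(v1 ↔ v2) = 1/2`). -/

variable (m : ℕ)

/-- The root `o`. -/
def v0 : Fin (m + 3) := ⟨0, by omega⟩
/-- The private finger `a₁`. -/
def v1 : Fin (m + 3) := ⟨1, by omega⟩
/-- The hub `a₂`. -/
def v2 : Fin (m + 3) := ⟨2, by omega⟩

@[simp] theorem v0_val : (v0 m).val = 0 := rfl
@[simp] theorem v1_val : (v1 m).val = 1 := rfl
@[simp] theorem v2_val : (v2 m).val = 2 := rfl

/-- Hub edges `v2 — j`, `j ≥ 3`. -/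
def IsHub (e : Sym2 (Fin (m + 3))) : Prop := ∃ j : Fin (m + 3), 3 ≤ j.val ∧ e = s(v2 m, j)

instance : DecidablePred (IsHub m) := fun e => by unfold IsHub; infer_instance

/-- The weights of the witness family. -/
noncomputable def wt (e : Sym2 (Fin (m + 3))) : unitInterval :=
  if e = s(v0 m, v1 m) then 1 else if e = s(v0 m, v2 m) then half else if IsHub m e then 1 else 0

theorem wt_01 : ((wt m s(v0 m, v1 m) : unitInterval) : ℝ) = 1 := by
  simp [wt]

theorem wt_02 : ((wt m s(v0 m, v2 m) : unitInterval) : ℝ) = 1 / 2 := by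
  have h : ¬ (s(v0 m, v2 m) : Sym2 (Fin (m + 3))) = s(v0 m, v1 m) := by
    simp only [Sym2.eq_iff, Fin.ext_iff, v0_val, v1_val, v2_val]; omega
  simp [wt, h]

theorem wt_hub (j : Fin (m + 3)) (hj : 3 ≤ j.val) : ((wt m s(v2 m, j) : unitInterval) : ℝ) = 1 := by
  have h1 : ¬ (s(v2 m, j) : Sym2 (Fin (m + 3))) = s(v0 m, v1 m) := by
    simp only [Sym2.eq_iff, Fin.ext_iff, v0_val, v1_val, v2_val]; omega
  have h2 : ¬ (s(v2 m, j) : Sym2 (Fin (m + 3))) = s(v0 m, v2 m) := by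
    simp only [Sym2.eq_iff, Fin.ext_iff, v0_val, v2_val]; omega
  have h3 : IsHub m s(v2 m, j) := ⟨j, hj, rfl⟩
  simp [wt, h1, h2, h3]

theorem wt_v0 (y : Fin (m + 3)) (hy : 3 ≤ y.val) : wt m s(v0 m, y) = 0 := by
  have h1 : ¬ (s(v0 m, y) : Sym2 (Fin (m + 3))) = s(v0 m, v1 m) := by
    simp only [Sym2.eq_iff, Fin.ext_iff, v0_val, v1_val]; omega
  have h2 : ¬ (s(v0 m, y) : Sym2 (Fin (m + 3))) = s(v0 m, v2 m) := by
    simp only [Sym2.eq_iff, Fin.ext_iff, v0_val, v2_val]; omega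
  have h3 : ¬ IsHub m s(v0 m, y) := by
    rintro ⟨j, hj, hji⟩
    simp only [Sym2.eq_iff, Fin.ext_iff, v0_val, v2_val] at hji; omega
  simp [wt, h1, h2, h3]

theorem wt_v1 (y : Fin (m + 3)) (hy : 2 ≤ y.val) : wt m s(v1 m, y) = 0 := by
  have h1 : ¬ (s(v1 m, y) : Sym2 (Fin (m + 3))) = s(v0 m, v1 m) := by
    simp only [Sym2.eq_iff, Fin.ext_iff, v0_val, v1_val]; omega
  have h2 : ¬ (s(v1 m, y) : Sym2 (Fin (m + 3))) = s(v0 m, v2 m) := by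
    simp only [Sym2.eq_iff, Fin.ext_iff, v0_val, v1_val, v2_val]; omega
  have h3 : ¬ IsHub m s(v1 m, y) := by
    rintro ⟨j, hj, hji⟩
    simp only [Sym2.eq_iff, Fin.ext_iff, v1_val, v2_val] at hji; omega
  simp [wt, h1, h2, h3]

/-- The hub leaves, as an explicit image of `Fin m` (so that the cardinality is `m`). -/
def leaves : Finset (Fin (m + 3)) :=
  (Finset.univ : Finset (Fin m)).image fun i => ⟨i.val + 3, by omega⟩

theorem card_leaves : (leaves m).card = m := by
  rw [leaves, Finset.card_image_of_injective _ fun i j hij => ?_]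
  · simp
  · simp [Fin.ext_iff] at hij; exact Fin.ext hij

theorem three_le_of_mem_leaves {j : Fin (m + 3)} (hj : j ∈ leaves m) : 3 ≤ j.val := by
  simp only [leaves, Finset.mem_image, Finset.mem_univ, true_and] at hj
  obtain ⟨i, rfl⟩ := hj
  simp

/-- The good event: finger open, switch closed, all weight-zero pairs closed. -/
def good : Set (Set (Sym2 (Fin (m + 3)))) :=
  {ω | s(v0 m, v1 m) ∈ ω ∧ s(v0 m, v2 m) ∉ ω ∧
    ∀ e ∈ (Finset.univ.filter fun e => wt m e = 0), e ∉ ω}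

/-- `P(good) ≥ 1/2` (union bound on the complement). -/
theorem half_le_good : 1 / 2 ≤ (prodBernoulli (wt m)).real (good m) := by
  set P := prodBernoulli (wt m) with hP
  have hc : P.real (good m)ᶜ ≤ 1 / 2 := by
    have hsub : (good m)ᶜ ⊆ ({ω | s(v0 m, v1 m) ∉ ω} ∪ {ω | s(v0 m, v2 m) ∈ ω}) ∪
        {ω | ∃ e ∈ (Finset.univ.filter fun e => wt m e = 0), e ∈ ω} := by
      intro ω hω
      simp only [good, Set.mem_compl_iff, Set.mem_setOf_eq, not_and, not_forall, not_not] at hω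
      simp only [Set.mem_union, Set.mem_setOf_eq]
      by_cases h1 : s(v0 m, v1 m) ∈ ω
      · by_cases h2 : s(v0 m, v2 m) ∈ ω
        · exact Or.inl (Or.inr h2)
        · obtain ⟨e, he, hee⟩ := hω h1 h2
          exact Or.inr ⟨e, he, hee⟩
      · exact Or.inl (Or.inl h1)
    calc P.real (good m)ᶜ
        ≤ P.real (({ω | s(v0 m, v1 m) ∉ ω} ∪ {ω | s(v0 m, v2 m) ∈ ω}) ∪
            {ω | ∃ e ∈ (Finset.univ.filter fun e => wt m e = 0), e ∈ ω}) := measureReal_mono hsub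
      _ ≤ (P.real {ω | s(v0 m, v1 m) ∉ ω} + P.real {ω | s(v0 m, v2 m) ∈ ω}) +
            P.real {ω | ∃ e ∈ (Finset.univ.filter fun e => wt m e = 0), e ∈ ω} :=
          le_trans (measureReal_union_le _ _) (add_le_add (measureReal_union_le _ _) le_rfl)
      _ ≤ ((1 - 1) + 1 / 2) + 0 := by
          gcongr
          · rw [hP, prodBernoulli_real_setOf_notMem, wt_01]
          · rw [hP, prodBernoulli_real_setOf_mem, wt_02]
          · refine le_trans (prodBernoulli_real_exists_mem_le_sum _ _) (le_of_eq ?_)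
            refine Finset.sum_eq_zero fun e he => ?_
            simp only [Finset.mem_filter, Finset.mem_univ, true_and] at he
            simp [he]
      _ = 1 / 2 := by norm_num
  rw [probReal_compl_eq_one_sub (measurableSet_config _)] at hc
  linarith

/-- On `good`, the cluster of `o = v0` meets `A = univ \ {v0}` exactly in `{v1}`. -/
theorem filter_eq_of_good {ω : Set (Sym2 (Fin (m + 3)))} (hω : ω ∈ good m)
    [DecidablePred fun a => ω ∈ openConn (v0 m) a] :
    (Finset.univ.erase (v0 m)).filter (fun a => ω ∈ openConn (v0 m) a) = {v1 m} := by
  obtain ⟨h01, h02, hzero⟩ := hω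
  have hzero' : ∀ e, wt m e = 0 → e ∉ ω := fun e he =>
    hzero e (Finset.mem_filter.2 ⟨Finset.mem_univ _, he⟩)
  -- `T = {v0, v1}` is closed under open adjacency
  have hT : ∀ x y, x ∈ ({v0 m, v1 m} : Set (Fin (m + 3))) → (openGraph ω).Adj x y →
      y ∈ ({v0 m, v1 m} : Set (Fin (m + 3))) := by
    intro x y hx hxy
    rw [openGraph_adj] at hxy
    obtain ⟨hmem, hne⟩ := hxy
    by_contra hy
    simp only [Set.mem_insert_iff, Set.mem_singleton_iff, not_or] at hy
    have hy2 : 2 ≤ y.val := by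
      rcases Nat.lt_or_ge y.val 2 with h | h
      · exfalso
        interval_cases hv : y.val
        · exact hy.1 (Fin.ext hv)
        · exact hy.2 (Fin.ext hv)
      · exact h
    rcases hx with rfl | rfl
    · rcases Nat.lt_or_ge y.val 3 with h3 | h3
      · have : y = v2 m := Fin.ext (by simp; omega)
        subst this
        exact h02 hmem
      · exact hzero' _ (wt_v0 m y h3) hmem
    · exact hzero' _ (wt_v1 m y hy2) hmem
  ext a
  simp only [Finset.mem_filter, Finset.mem_erase, Finset.mem_univ, and_true,
    Finset.mem_singleton]
  constructor
  · rintro ⟨ha0, hreach⟩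
    have hmemT := mem_of_reachable_of_closed hT hreach (by simp)
    simp only [Set.mem_insert_iff, Set.mem_singleton_iff] at hmemT
    exact hmemT.resolve_left ha0
  · rintro rfl
    refine ⟨fun h => by simp [Fin.ext_iff] at h, ?_⟩
    exact SimpleGraph.Adj.reachable ((openGraph_adj ω _ _).2 ⟨h01, fun h => by simp [Fin.ext_iff] at h⟩)

/-- Lower bound on the mean: `m / 2 ≤ EN`. -/
theorem mean_ge : (m : ℝ) / 2 ≤
    ∑ a ∈ Finset.univ.erase (v0 m), (prodBernoulli (wt m)).real (openConn (v0 m) a) := by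
  set P := prodBernoulli (wt m) with hP
  have hsub : leaves m ⊆ Finset.univ.erase (v0 m) := by
    intro j hj
    have := three_le_of_mem_leaves m hj
    exact Finset.mem_erase.2 ⟨fun h => by rw [h] at this; simp at this, Finset.mem_univ _⟩
  have hleaf : ∀ j ∈ leaves m, (1 : ℝ) / 2 ≤ P.real (openConn (v0 m) j) := by
    intro j hj
    have h3 := three_le_of_mem_leaves m hj
    have hne : (s(v0 m, v2 m) : Sym2 (Fin (m + 3))) ≠ s(v2 m, j) := by
      simp only [Ne, Sym2.eq_iff, Fin.ext_iff, v0_val, v2_val]; omega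
    have hF : P.real {ω | ((({s(v0 m, v2 m), s(v2 m, j)} : Finset _) : Set (Sym2 (Fin (m + 3)))) ⊆ ω)}
        = 1 / 2 := by
      rw [hP, prodBernoulli_real_subset, Finset.prod_pair hne, wt_02, wt_hub m j h3, mul_one]
    rw [← hF]
    refine measureReal_mono fun ω hω => ?_
    simp only [Finset.coe_insert, Finset.coe_singleton, Set.mem_setOf_eq, Set.insert_subset_iff,
      Set.singleton_subset_iff] at hω
    have h02 : (openGraph ω).Adj (v0 m) (v2 m) :=
      (openGraph_adj ω _ _).2 ⟨hω.1, fun h => by simp [Fin.ext_iff] at h⟩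
    have h2j : (openGraph ω).Adj (v2 m) j :=
      (openGraph_adj ω _ _).2 ⟨hω.2, fun h => by rw [← h] at h3; simp at h3⟩
    exact h02.reachable.trans h2j.reachable
  calc (m : ℝ) / 2 = ∑ j ∈ leaves m, (1 : ℝ) / 2 := by simp [card_leaves]; ring
    _ ≤ ∑ j ∈ leaves m, P.real (openConn (v0 m) j) := Finset.sum_le_sum hleaf
    _ ≤ _ := Finset.sum_le_sum_of_subset_of_nonneg hsub fun _ _ _ => measureReal_nonneg

end Witness

/-- **Hypothesis 2 is load-bearing: without pairwise reliability of the relay set the lower tail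
of `N` can carry mass `1/2`.** Witness: the family `W_m` above with `ε = 1/4`, `m > 1/δ`.
Any proof of the crux must use `∀ a a' ∈ A, P(a ↔ a') > 1 − δ`. [folklore] -/
theorem noHeavyLowerTail_false_without_pairwise : ¬ NoHeavyLowerTailWithoutPairwise := by
  classical
  intro h
  obtain ⟨δ, hδ, hmain⟩ := h (1 / 4) (by norm_num)
  obtain ⟨m, hm⟩ := exists_nat_gt (1 / δ)
  have hmδ : 1 < δ * m := by
    rw [div_lt_iff₀ hδ] at hm; linarith
  have h1 : 1 - δ < (prodBernoulli (wt m)).real (⋃ a ∈ Finset.univ.erase (v0 m), openConn (v0 m) a) := by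
    have : (prodBernoulli (wt m)).real {ω | s(v0 m, v1 m) ∈ ω} = 1 := by
      rw [prodBernoulli_real_setOf_mem, wt_01]
    have hle : (1 : ℝ) ≤ (prodBernoulli (wt m)).real (⋃ a ∈ Finset.univ.erase (v0 m), openConn (v0 m) a) := by
      rw [← this]
      refine measureReal_mono (fun ω hω => ?_) (measure_ne_top _ _)
      simp only [Set.mem_setOf_eq] at hω
      simp only [Set.mem_iUnion, exists_prop, Finset.mem_erase, Finset.mem_univ, and_true]
      refine ⟨v1 m, fun h => by simp [Fin.ext_iff] at h, ?_⟩
      exact SimpleGraph.Adj.reachable ((openGraph_adj ω _ _).2 ⟨hω, fun h => by simp [Fin.ext_iff] at h⟩)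
    linarith
  have hbad := hmain (m + 3) (wt m) (Finset.univ.erase (v0 m)) (v0 m) h1
  -- `good ⊆ Bad`, hence `1/2 ≤ P(good) ≤ P(Bad) < 1/4`
  have hmean := mean_ge m
  have hgood : (prodBernoulli (wt m)).real (good m) < 1 / 4 := by
    refine lt_of_le_of_lt (measureReal_mono (fun ω hω => ?_) (measure_ne_top _ _)) hbad
    simp only [Set.mem_setOf_eq]
    rw [filter_eq_of_good m hω, Finset.card_singleton]
    refine ⟨le_rfl, ?_⟩
    push_cast
    rw [div_eq_mul_inv, show ((1 : ℝ) / 4)⁻¹ = 4 by norm_num]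
    nlinarith
  linarith [half_le_good m]


/-! ### C.2 Hypothesis 1 (`P(o ↔ A) > 1 − δ`) — NOT cheaply removable: the H1-free statement
follows from the route's proxy `AdditiveGluing` (item 4576), a fortiori from KN Conjecture 1 -/

/-- **Kozma–Nitzan Conjecture 1** (arXiv:2401.12397, p.3: `P(o ↔ b) ≥ P(o ↔ A) · min_{a ∈ A}
P(a ↔ b)` on every finite weighted graph), typed min-free: any common lower bound `t` of the
`P(a ↔ b)`, `a ∈ A`, gives `P(o ↔ A) · t ≤ P(o ↔ b)`. OPEN (KN: "we were not able to prove or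
disprove"; proved for `|A| = 2` and a special `|A| = 3`, KN Thms 1–2). Declared here only as a
hypothesis of the relative results below. -/
def KNConjecture1 : Prop :=
  ∀ (n : ℕ) (w : Sym2 (Fin n) → unitInterval) (A : Finset (Fin n)) (o b : Fin n) (t : ℝ),
    (∀ a ∈ A, t ≤ (prodBernoulli w).real (openConn a b)) →
      (prodBernoulli w).real (⋃ a ∈ A, openConn o a) * t ≤ (prodBernoulli w).real (openConn o b)

open scoped Classical in
/-- The crux with hypothesis 1 (`P(o ↔ A) > 1 − δ`) deleted. -/
def NoHeavyLowerTailWithoutReach : Prop :=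
  ∀ ε : ℝ, 0 < ε → ∃ δ : ℝ, 0 < δ ∧ ∀ (n : ℕ) (w : Sym2 (Fin n) → unitInterval)
    (A : Finset (Fin n)) (o : Fin n),
    (∀ a ∈ A, ∀ a' ∈ A, 1 - δ < (prodBernoulli w).real (openConn a a')) →
      (prodBernoulli w).real {ω | 1 ≤ (A.filter fun a => ω ∈ openConn o a).card ∧
        ((A.filter fun a => ω ∈ openConn o a).card : ℝ) <
          δ * (∑ a ∈ A, (prodBernoulli w).real (openConn o a)) / ε} < ε

/-- **KN Conjecture 1 implies the route's finitely-refutable proxy `AdditiveGluing` (item 4576)**: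
`P(o ↔ A) − t ≤ P(o ↔ A)(1 − t) ≤ P(o ↔ b)`. [folklore] -/
theorem additiveGluing_of_KNConjecture1 (hC1 : KNConjecture1) : AdditiveGluing := by
  intro n w A o b t ht hb
  have h1 := hC1 n w A o b (1 - t) hb
  have hU : (prodBernoulli w).real (⋃ a ∈ A, openConn o a) ≤ 1 := measureReal_le_one
  have hU0 : 0 ≤ (prodBernoulli w).real (⋃ a ∈ A, openConn o a) := measureReal_nonneg
  nlinarith [mul_nonneg ht (sub_nonneg.2 hU)]

/-- **Under `AdditiveGluing` (a fortiori under KN Conjecture 1), `o` meets `A` but misses a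
reliable `a₀ ∈ A` with probability at most `η`**: `P({o ↔ A} ∖ {o ↔ a₀}) = P(o ↔ A) − P(o ↔ a₀)
≤ η`. [folklore] -/
theorem reach_sdiff_le_of_additiveGluing (hAG : AdditiveGluing) {n : ℕ}
    (w : Sym2 (Fin n) → unitInterval) (A : Finset (Fin n)) (o a₀ : Fin n) (ha₀ : a₀ ∈ A) (η : ℝ)
    (hη : ∀ a ∈ A, 1 - η ≤ (prodBernoulli w).real (openConn a a₀)) :
    (prodBernoulli w).real ((⋃ a ∈ A, openConn o a) \ openConn o a₀) ≤ η := by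
  have hsub : openConn o a₀ ⊆ ⋃ a ∈ A, openConn o a :=
    fun ω hω => Set.mem_biUnion (Finset.mem_coe.2 ha₀) hω
  have hη0 : 0 ≤ η := by
    have := hη a₀ ha₀
    linarith [(measureReal_le_one : (prodBernoulli w).real (openConn a₀ a₀) ≤ 1)]
  have h1 := hAG n w A o a₀ η hη0 hη
  rw [measureReal_sdiff hsub (measurableSet_config _) (measure_ne_top _ _)]
  linarith

/-- The KN-Conjecture-1 form of the previous lemma. [folklore] -/
theorem reach_sdiff_le_of_KNConjecture1 (hC1 : KNConjecture1) {n : ℕ}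
    (w : Sym2 (Fin n) → unitInterval) (A : Finset (Fin n)) (o a₀ : Fin n) (ha₀ : a₀ ∈ A) (η : ℝ)
    (hη : ∀ a ∈ A, 1 - η ≤ (prodBernoulli w).real (openConn a a₀)) :
    (prodBernoulli w).real ((⋃ a ∈ A, openConn o a) \ openConn o a₀) ≤ η :=
  reach_sdiff_le_of_additiveGluing (additiveGluing_of_KNConjecture1 hC1) w A o a₀ ha₀ η hη

/-- **`AdditiveGluing` (item 4576; a fortiori KN Conjecture 1) implies the crux WITHOUT
hypothesis 1, with the linear rate `δ = ε/16`.** So hypothesis 1 cannot be shown load-bearing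
without refuting `AdditiveGluing` (hence KN Conjecture 1): a witness against
`NoHeavyLowerTailWithoutReach` is a one-graph counterexample to 4576.
Proof: `Bad ∩ {o ↔ a₀} ⊆ {N_{a₀} < t}` (counting, `< 16δ/15`) and
`Bad ∩ {o ↮ a₀} ⊆ {o ↔ A} \ {o ↔ a₀}` (`≤ δ` by additivity). [folklore] -/
theorem withoutReach_of_additiveGluing (hAG : AdditiveGluing) : NoHeavyLowerTailWithoutReach := by
  classical
  intro ε hε
  refine ⟨ε / 16, by positivity, ?_⟩
  intro n w A o hpair
  set δ := ε / 16 with hδ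
  set P := prodBernoulli w with hP
  by_cases hε1 : 1 < ε
  · exact lt_of_le_of_lt measureReal_le_one hε1
  push Not at hε1
  rcases A.eq_empty_or_nonempty with hAe | ⟨a₀, ha₀⟩
  · -- empty relay set: the event asks `1 ≤ 0`
    subst hAe
    have : P.real {ω | 1 ≤ ((∅ : Finset (Fin n)).filter fun a => ω ∈ openConn o a).card ∧
        (((∅ : Finset (Fin n)).filter fun a => ω ∈ openConn o a).card : ℝ) <
          δ * (∑ a ∈ (∅ : Finset (Fin n)), P.real (openConn o a)) / ε} ≤ P.real (∅ : Set _) :=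
      measureReal_mono (fun ω hω => by simp at hω) (measure_ne_top _ _)
    simp only [measureReal_empty] at this
    linarith [this]
  set M : ℕ := A.card with hM
  set EN : ℝ := ∑ a ∈ A, P.real (openConn o a) with hEN
  have hENle : EN ≤ M := by
    calc EN ≤ ∑ a ∈ A, (1 : ℝ) := Finset.sum_le_sum fun a _ => measureReal_le_one
      _ = M := by simp [hM]
  have hENnn : 0 ≤ EN := Finset.sum_nonneg fun a _ => measureReal_nonneg
  have hMpos : (1 : ℝ) ≤ M := by exact_mod_cast Finset.card_pos.2 ⟨a₀, ha₀⟩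
  set t : ℝ := δ * EN / ε with ht
  have htM : t ≤ M / 16 := by
    rw [ht, div_le_div_iff₀ hε (by norm_num : (0:ℝ) < 16)]
    have : δ * EN ≤ ε / 16 * M := mul_le_mul le_rfl hENle hENnn (by positivity)
    nlinarith
  let S₁ : Set (Set (Sym2 (Fin n))) := {ω | ((A.filter fun a => ω ∈ openConn a₀ a).card : ℝ) < t}
  have hcount : ((M : ℝ) - t) * P.real S₁ ≤ M * δ := by
    refine ownCount_lowerTail_le w A a₀ δ t (fun a ha => ?_)
    rw [probReal_compl_eq_one_sub (measurableSet_config _)]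
    linarith [hpair a₀ ha₀ a ha]
  have hS₁ : P.real S₁ ≤ 16 * δ / 15 := by
    have h15 : (15 : ℝ) * M / 16 ≤ M - t := by linarith
    have hle : (M : ℝ) * (15 / 16 * P.real S₁) ≤ M * δ := by
      calc (M : ℝ) * (15 / 16 * P.real S₁) = 15 * M / 16 * P.real S₁ := by ring
        _ ≤ (M - t) * P.real S₁ := mul_le_mul_of_nonneg_right h15 measureReal_nonneg
        _ ≤ M * δ := hcount
    have := le_of_mul_le_mul_left hle (by positivity)
    linarith
  have hdiff : P.real ((⋃ a ∈ A, openConn o a) \ openConn o a₀) ≤ δ :=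
    reach_sdiff_le_of_additiveGluing hAG w A o a₀ ha₀ δ fun a ha => (hpair a ha a₀ ha₀).le
  refine lt_of_le_of_lt (measureReal_mono (s₂ := ((⋃ a ∈ A, openConn o a) \ openConn o a₀) ∪ S₁)
    ?_ (measure_ne_top _ _)) ?_
  · intro ω hω
    simp only [Set.mem_setOf_eq] at hω
    obtain ⟨h1, h2⟩ := hω
    by_cases ho : ω ∈ openConn o a₀
    · right
      have hfc : (A.filter fun a => ω ∈ openConn o a) = (A.filter fun a => ω ∈ openConn a₀ a) := by
        refine Finset.filter_congr fun a _ => ?_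
        simp only [openConn, Set.mem_setOf_eq] at ho ⊢
        exact ⟨fun h => ho.symm.trans h, fun h => ho.trans h⟩
      show ((A.filter fun a => ω ∈ openConn a₀ a).card : ℝ) < t
      rw [← hfc]
      exact h2
    · left
      refine ⟨?_, ho⟩
      obtain ⟨a, ha⟩ := Finset.card_pos.1 h1
      rw [Finset.mem_filter] at ha
      exact Set.mem_biUnion (Finset.mem_coe.2 ha.1) ha.2
  · calc P.real (((⋃ a ∈ A, openConn o a) \ openConn o a₀) ∪ S₁)
        ≤ P.real ((⋃ a ∈ A, openConn o a) \ openConn o a₀) + P.real S₁ := measureReal_union_le _ _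
      _ ≤ δ + 16 * δ / 15 := add_le_add hdiff hS₁
      _ < ε := by rw [hδ]; linarith

/-- KN Conjecture 1 form. [folklore] -/
theorem withoutReach_of_KNConjecture1 (hC1 : KNConjecture1) : NoHeavyLowerTailWithoutReach :=
  withoutReach_of_additiveGluing (additiveGluing_of_KNConjecture1 hC1)

/-! ## D. Natural strengthenings

### D.1 The λ-uniform LINEAR form (planner: "refuters should test that form first") is implied by
KN Conjecture 1 with constant 3, and implies the crux -/

open scoped Classical in
/-- The linear, `λ`-uniform lower-tail bound with constant `C`:
`P(1 ≤ N < EN/2) ≤ C · (P(o ↮ A) + max_{a,a'} P(a ↮ a'))`, typed with a common upper bound `η`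
of the pairwise disconnection probabilities. -/
def LinearForm (C : ℝ) : Prop :=
  ∀ (n : ℕ) (w : Sym2 (Fin n) → unitInterval) (A : Finset (Fin n)) (o : Fin n) (η : ℝ), 0 ≤ η →
    (∀ a ∈ A, ∀ a' ∈ A, (prodBernoulli w).real (openConn a a')ᶜ ≤ η) →
      (prodBernoulli w).real {ω | 1 ≤ (A.filter fun a => ω ∈ openConn o a).card ∧
        ((A.filter fun a => ω ∈ openConn o a).card : ℝ) <
          (∑ a ∈ A, (prodBernoulli w).real (openConn o a)) / 2} ≤
        C * ((prodBernoulli w).real (⋃ a ∈ A, openConn o a)ᶜ + η)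

/-- **`AdditiveGluing` (item 4576; a fortiori KN Conjecture 1) ⟹ the linear form with `C = 3`**
(even without the `P(o ↮ A)` term): `2η` from counting on `{o ↔ a₀}` plus `η` from additivity on
`{o ↮ a₀}`. Consequently an exact small-graph sweep can only exhibit a ratio `> 3` by refuting
`AdditiveGluing` (and KN Conjecture 1) itself — the 4576 sweep subsumes the linear-form sweep.
[folklore] -/
theorem linearForm_three_of_additiveGluing (hAG : AdditiveGluing) : LinearForm 3 := by
  classical
  intro n w A o η hη0 hη
  set P := prodBernoulli w with hP
  rcases A.eq_empty_or_nonempty with hAe | ⟨a₀, ha₀⟩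
  · subst hAe
    have : P.real {ω | 1 ≤ ((∅ : Finset (Fin n)).filter fun a => ω ∈ openConn o a).card ∧
        (((∅ : Finset (Fin n)).filter fun a => ω ∈ openConn o a).card : ℝ) <
          (∑ a ∈ (∅ : Finset (Fin n)), P.real (openConn o a)) / 2} ≤ P.real (∅ : Set _) :=
      measureReal_mono (fun ω hω => by simp at hω) (measure_ne_top _ _)
    simp only [measureReal_empty] at this
    have h0 : 0 ≤ P.real (⋃ a ∈ (∅ : Finset (Fin n)), openConn o a)ᶜ := measureReal_nonneg
    nlinarith [this]
  set M : ℕ := A.card with hM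
  set EN : ℝ := ∑ a ∈ A, P.real (openConn o a) with hEN
  have hENle : EN ≤ M := by
    calc EN ≤ ∑ a ∈ A, (1 : ℝ) := Finset.sum_le_sum fun a _ => measureReal_le_one
      _ = M := by simp [hM]
  have hMpos : (1 : ℝ) ≤ M := by exact_mod_cast Finset.card_pos.2 ⟨a₀, ha₀⟩
  let S₁ : Set (Set (Sym2 (Fin n))) :=
    {ω | ((A.filter fun a => ω ∈ openConn a₀ a).card : ℝ) < EN / 2}
  have hcount : ((M : ℝ) - EN / 2) * P.real S₁ ≤ M * η :=
    ownCount_lowerTail_le w A a₀ η (EN / 2) fun a ha => hη a₀ ha₀ a ha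
  have hS₁ : P.real S₁ ≤ 2 * η := by
    have h2 : (M : ℝ) / 2 ≤ M - EN / 2 := by linarith
    have hle : (M : ℝ) * (1 / 2 * P.real S₁) ≤ M * η := by
      calc (M : ℝ) * (1 / 2 * P.real S₁) = M / 2 * P.real S₁ := by ring
        _ ≤ (M - EN / 2) * P.real S₁ := mul_le_mul_of_nonneg_right h2 measureReal_nonneg
        _ ≤ M * η := hcount
    have := le_of_mul_le_mul_left hle (by positivity)
    linarith
  have hdiff : P.real ((⋃ a ∈ A, openConn o a) \ openConn o a₀) ≤ η := by
    refine reach_sdiff_le_of_additiveGluing hAG w A o a₀ ha₀ η fun a ha => ?_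
    have := hη a ha a₀ ha₀
    rw [probReal_compl_eq_one_sub (measurableSet_config _)] at this
    linarith
  have hUc : 0 ≤ P.real (⋃ a ∈ A, openConn o a)ᶜ := measureReal_nonneg
  refine le_trans (measureReal_mono (s₂ := ((⋃ a ∈ A, openConn o a) \ openConn o a₀) ∪ S₁)
    ?_ (measure_ne_top _ _)) ?_
  · intro ω hω
    simp only [Set.mem_setOf_eq] at hω
    obtain ⟨h1, h2⟩ := hω
    by_cases ho : ω ∈ openConn o a₀
    · right
      have hfc : (A.filter fun a => ω ∈ openConn o a) = (A.filter fun a => ω ∈ openConn a₀ a) := by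
        refine Finset.filter_congr fun a _ => ?_
        simp only [openConn, Set.mem_setOf_eq] at ho ⊢
        exact ⟨fun h => ho.symm.trans h, fun h => ho.trans h⟩
      show ((A.filter fun a => ω ∈ openConn a₀ a).card : ℝ) < EN / 2
      rw [← hfc]
      exact h2
    · left
      refine ⟨?_, ho⟩
      obtain ⟨a, ha⟩ := Finset.card_pos.1 h1
      rw [Finset.mem_filter] at ha
      exact Set.mem_biUnion (Finset.mem_coe.2 ha.1) ha.2
  · calc P.real (((⋃ a ∈ A, openConn o a) \ openConn o a₀) ∪ S₁)
        ≤ P.real ((⋃ a ∈ A, openConn o a) \ openConn o a₀) + P.real S₁ := measureReal_union_le _ _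
      _ ≤ η + 2 * η := add_le_add hdiff hS₁
      _ ≤ 3 * (P.real (⋃ a ∈ A, openConn o a)ᶜ + η) := by nlinarith

/-- KN Conjecture 1 form. [folklore] -/
theorem linearForm_three_of_KNConjecture1 (hC1 : KNConjecture1) : LinearForm 3 :=
  linearForm_three_of_additiveGluing (additiveGluing_of_KNConjecture1 hC1)

/-- For completeness (route item 4578, `AdditiveGluingSuffices`, already has a candidate proof):
`AdditiveGluing → NearOneGluing` with `δ = ε/2`. [folklore] -/
theorem nearOneGluing_of_additiveGluing (hAG : AdditiveGluing) : NearOneGluing := by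
  intro ε hε
  refine ⟨ε / 2, by positivity, ?_⟩
  intro n w A o b hA hb
  have h := hAG n w A o b (ε / 2) (by positivity) fun a ha => (hb a ha).le
  linarith

/-- The hierarchy, top to bottom: `KNConjecture1 → AdditiveGluing → NearOneGluing ↔
NoHeavyLowerTail`. [folklore] -/
theorem of_KNConjecture1 (hC1 : KNConjecture1) : NoHeavyLowerTail :=
  of_nearOneGluing (nearOneGluing_of_additiveGluing (additiveGluing_of_KNConjecture1 hC1))

/-- **Any linear form implies the crux** (`δ := ε / (2 (C + 2))`): the planner's reduction, made
formal. [folklore] -/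
theorem of_linearForm {C : ℝ} (hC : 0 ≤ C) (hL : LinearForm C) : NoHeavyLowerTail := by
  classical
  intro ε hε
  refine ⟨ε / (2 * (C + 2)), by positivity, ?_⟩
  intro n w A o hA hpair
  set δ := ε / (2 * (C + 2)) with hδ
  set P := prodBernoulli w with hP
  have hδε : δ ≤ ε / 2 := by
    rw [hδ, div_le_div_iff₀ (by positivity) (by norm_num : (0:ℝ) < 2)]; nlinarith
  have hδpos : 0 < δ := by positivity
  set EN : ℝ := ∑ a ∈ A, P.real (openConn o a) with hEN
  have hENnn : 0 ≤ EN := Finset.sum_nonneg fun a _ => measureReal_nonneg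
  have hη : ∀ a ∈ A, ∀ a' ∈ A, P.real (openConn a a')ᶜ ≤ δ := by
    intro a ha a' ha'
    rw [probReal_compl_eq_one_sub (measurableSet_config _)]
    linarith [hpair a ha a' ha']
  have hlin := hL n w A o δ hδpos.le hη
  have hUc : P.real (⋃ a ∈ A, openConn o a)ᶜ < δ := by
    rw [probReal_compl_eq_one_sub (measurableSet_config _)]; linarith
  refine lt_of_le_of_lt (le_trans (measureReal_mono (fun ω hω => ?_) (measure_ne_top _ _)) hlin) ?_
  · simp only [Set.mem_setOf_eq] at hω ⊢
    refine ⟨hω.1, lt_of_lt_of_le hω.2 ?_⟩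
    rw [div_le_div_iff₀ hε (by norm_num : (0:ℝ) < 2)]
    nlinarith
  · calc C * (P.real (⋃ a ∈ A, openConn o a)ᶜ + δ) ≤ C * (δ + δ) := by gcongr
      _ < ε := by
        have hC2 : (0 : ℝ) < C + 2 := by positivity
        have : C * (δ + δ) = C * ε / (C + 2) := by rw [hδ]; field_simp; ring
        rw [this, div_lt_iff₀ hC2]; nlinarith

/-! ### D.2 The order of quantifiers matters: no `δ` serves all `ε` -/

open scoped Classical in
/-- The crux with `∃ δ ∀ ε` in place of `∀ ε ∃ δ`. -/
def NoHeavyLowerTailUniform : Prop :=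
  ∃ δ : ℝ, 0 < δ ∧ ∀ ε : ℝ, 0 < ε → ∀ (n : ℕ) (w : Sym2 (Fin n) → unitInterval)
    (A : Finset (Fin n)) (o : Fin n),
    1 - δ < (prodBernoulli w).real (⋃ a ∈ A, openConn o a) →
      (∀ a ∈ A, ∀ a' ∈ A, 1 - δ < (prodBernoulli w).real (openConn a a')) →
        (prodBernoulli w).real {ω | 1 ≤ (A.filter fun a => ω ∈ openConn o a).card ∧
          ((A.filter fun a => ω ∈ openConn o a).card : ℝ) <
            δ * (∑ a ∈ A, (prodBernoulli w).real (openConn o a)) / ε} < ε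

/-- **Refuted strengthening: a uniform `δ` is impossible** — already for one vertex `A = {o}`
(`N ≡ 1`, `EN = 1`), at `ε = min (δ/2) (1/2)` the event is everything. The threshold `δ·EN/ε`
makes the statement say something only about relay sets with `EN > ε/δ`. [folklore] -/
theorem not_noHeavyLowerTail_uniform : ¬ NoHeavyLowerTailUniform := by
  classical
  rintro ⟨δ, hδ, h⟩
  set ε : ℝ := min (δ / 2) (1 / 2) with hε
  have hεpos : 0 < ε := lt_min (by positivity) (by norm_num)
  have hεδ : ε ≤ δ / 2 := min_le_left _ _
  have hε1 : ε ≤ 1 / 2 := min_le_right _ _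
  have hconn : (openConn (0 : Fin 1) (0 : Fin 1) : Set (Set (Sym2 (Fin 1)))) = Set.univ := by
    ext ω; simp [openConn]
  have hU : (⋃ a ∈ ({0} : Finset (Fin 1)), openConn (0 : Fin 1) a) = Set.univ := by
    ext ω; simp [openConn]
  have hmain := h ε hεpos 1 (fun _ => 0) {0} 0 (by rw [hU, probReal_univ]; linarith)
    (fun a ha a' ha' => by
      rw [Finset.mem_singleton] at ha ha'
      subst ha; subst ha'
      rw [hconn, probReal_univ]; linarith)
  have hall : (prodBernoulli (fun _ : Sym2 (Fin 1) => (0 : unitInterval))).real (Set.univ) ≤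
      (prodBernoulli (fun _ : Sym2 (Fin 1) => (0 : unitInterval))).real
        {ω | 1 ≤ (({0} : Finset (Fin 1)).filter fun a => ω ∈ openConn (0 : Fin 1) a).card ∧
          ((({0} : Finset (Fin 1)).filter fun a => ω ∈ openConn (0 : Fin 1) a).card : ℝ) <
            δ * (∑ a ∈ ({0} : Finset (Fin 1)),
              (prodBernoulli (fun _ : Sym2 (Fin 1) => (0 : unitInterval))).real
                (openConn (0 : Fin 1) a)) / ε} := by
    refine measureReal_mono (fun ω _ => ?_) (measure_ne_top _ _)
    have hf : (({0} : Finset (Fin 1)).filter fun a => ω ∈ openConn (0 : Fin 1) a) = {0} := by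
      ext a; simp [openConn, Fin.eq_zero a]
    simp only [Set.mem_setOf_eq, hf, Finset.card_singleton, Finset.sum_singleton, hconn,
      probReal_univ, Nat.cast_one, le_refl, true_and, mul_one]
    rw [lt_div_iff₀ hεpos]; linarith
  rw [probReal_univ] at hall
  linarith

/-! ### D.3 The rate: `δ(ε) ≤ ε` is necessary (and `δ = ε/16` suffices under 4576, C.2) -/

section RateWitness

/-! The rate witness `R_{m,η}`: the chain `o = v0 —(1)— v1 —(1−η)— v2` and `m` hub leaves
`v2 —(1)— j` (`j ≥ 3`), all other pairs `0`; `A = univ \ {v0}`. The relay set is pairwise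
`(1−η)`-reliable, `P(o ↔ A) = 1`, and `N = 1` exactly when the edge `v1 v2` is closed
(probability `η`), while `EN ≥ m (1 − η)`. -/

variable (m : ℕ) (η : ℝ) (hη : η ∈ Set.Icc (0 : ℝ) 1)

/-- The weights of the rate witness. -/
noncomputable def wtR (m : ℕ) (η : ℝ) (hη : η ∈ Set.Icc (0 : ℝ) 1) (e : Sym2 (Fin (m + 3))) :
    unitInterval :=
  if e = s(v0 m, v1 m) then 1
  else if e = s(v1 m, v2 m) then ⟨1 - η, by constructor <;> linarith [hη.1, hη.2]⟩
  else if IsHub m e then 1 else 0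

theorem wtR_01 : ((wtR m η hη s(v0 m, v1 m) : unitInterval) : ℝ) = 1 := by
  simp [wtR]

theorem wtR_12 : ((wtR m η hη s(v1 m, v2 m) : unitInterval) : ℝ) = 1 - η := by
  have h : ¬ (s(v1 m, v2 m) : Sym2 (Fin (m + 3))) = s(v0 m, v1 m) := by
    simp only [Sym2.eq_iff, Fin.ext_iff, v0_val, v1_val, v2_val]; omega
  simp [wtR, h]

theorem wtR_hub (j : Fin (m + 3)) (hj : 3 ≤ j.val) :
    ((wtR m η hη s(v2 m, j) : unitInterval) : ℝ) = 1 := by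
  have h1 : ¬ (s(v2 m, j) : Sym2 (Fin (m + 3))) = s(v0 m, v1 m) := by
    simp only [Sym2.eq_iff, Fin.ext_iff, v0_val, v1_val, v2_val]; omega
  have h2 : ¬ (s(v2 m, j) : Sym2 (Fin (m + 3))) = s(v1 m, v2 m) := by
    simp only [Sym2.eq_iff, Fin.ext_iff, v1_val, v2_val]; omega
  have h3 : IsHub m s(v2 m, j) := ⟨j, hj, rfl⟩
  simp [wtR, h1, h2, h3]

theorem wtR_v0 (y : Fin (m + 3)) (hy : 2 ≤ y.val) : wtR m η hη s(v0 m, y) = 0 := by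
  have h1 : ¬ (s(v0 m, y) : Sym2 (Fin (m + 3))) = s(v0 m, v1 m) := by
    simp only [Sym2.eq_iff, Fin.ext_iff, v0_val, v1_val]; omega
  have h2 : ¬ (s(v0 m, y) : Sym2 (Fin (m + 3))) = s(v1 m, v2 m) := by
    simp only [Sym2.eq_iff, Fin.ext_iff, v0_val, v1_val, v2_val]; omega
  have h3 : ¬ IsHub m s(v0 m, y) := by
    rintro ⟨j, hj, hji⟩
    simp only [Sym2.eq_iff, Fin.ext_iff, v0_val, v2_val] at hji; omega
  simp [wtR, h1, h2, h3]

theorem wtR_v1 (y : Fin (m + 3)) (hy : 3 ≤ y.val) : wtR m η hη s(v1 m, y) = 0 := by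
  have h1 : ¬ (s(v1 m, y) : Sym2 (Fin (m + 3))) = s(v0 m, v1 m) := by
    simp only [Sym2.eq_iff, Fin.ext_iff, v0_val, v1_val]; omega
  have h2 : ¬ (s(v1 m, y) : Sym2 (Fin (m + 3))) = s(v1 m, v2 m) := by
    simp only [Sym2.eq_iff, Fin.ext_iff, v1_val, v2_val]; omega
  have h3 : ¬ IsHub m s(v1 m, y) := by
    rintro ⟨j, hj, hji⟩
    simp only [Sym2.eq_iff, Fin.ext_iff, v1_val, v2_val] at hji; omega
  simp [wtR, h1, h2, h3]

/-- The backbone edges: `v1 v2` and the hub edges. -/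
def backbone : Finset (Sym2 (Fin (m + 3))) :=
  insert s(v1 m, v2 m) ((leaves m).image fun j => s(v2 m, j))

theorem prob_backbone :
    (prodBernoulli (wtR m η hη)).real {ω | ((backbone m : Finset _) : Set (Sym2 (Fin (m + 3)))) ⊆ ω}
      = 1 - η := by
  rw [prodBernoulli_real_subset, backbone, Finset.prod_insert, wtR_12, Finset.prod_eq_one, mul_one]
  · intro e he
    simp only [Finset.mem_image] at he
    obtain ⟨j, hj, rfl⟩ := he
    exact wtR_hub m η hη j (three_le_of_mem_leaves m hj)
  · simp only [Finset.mem_image, not_exists, not_and]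
    intro j hj h
    have := three_le_of_mem_leaves m hj
    simp only [Sym2.eq_iff, Fin.ext_iff, v1_val, v2_val] at h; omega

/-- On the backbone event every relay point is joined to the hub `v2`. -/
theorem reachable_v2_of_backbone {ω : Set (Sym2 (Fin (m + 3)))}
    (hω : ((backbone m : Finset _) : Set (Sym2 (Fin (m + 3)))) ⊆ ω) {a : Fin (m + 3)}
    (ha : a ≠ v0 m) : (openGraph ω).Reachable (v2 m) a := by
  have h12 : s(v1 m, v2 m) ∈ ω := hω (by simp [backbone])
  by_cases h1 : a = v1 m
  · subst h1
    exact (SimpleGraph.Adj.reachable ((openGraph_adj ω _ _).2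
      ⟨h12, fun h => by simp [Fin.ext_iff] at h⟩)).symm
  by_cases h2 : a = v2 m
  · subst h2; rfl
  · have h3 : 3 ≤ a.val := by
      have h0 : a.val ≠ 0 := fun h => ha (Fin.ext h)
      have h1' : a.val ≠ 1 := fun h => h1 (Fin.ext h)
      have h2' : a.val ≠ 2 := fun h => h2 (Fin.ext h)
      omega
    have hmem : s(v2 m, a) ∈ ω := by
      refine hω ?_
      simp only [backbone, Finset.coe_insert, Finset.coe_image, Set.mem_insert_iff, Set.mem_image,
        Finset.mem_coe, leaves, Finset.mem_univ, true_and]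
      refine Or.inr ⟨a, ⟨⟨a.val - 3, by omega⟩, Fin.ext (by simp; omega)⟩, rfl⟩
    exact SimpleGraph.Adj.reachable ((openGraph_adj ω _ _).2
      ⟨hmem, fun h => by rw [← h] at h3; simp at h3⟩)

/-- Pairwise reliability of `A = univ \ {v0}`: `1 − η ≤ P(a ↔ a')`. -/
theorem pair_geR {a a' : Fin (m + 3)} (ha : a ≠ v0 m) (ha' : a' ≠ v0 m) :
    1 - η ≤ (prodBernoulli (wtR m η hη)).real (openConn a a') := by
  rw [← prob_backbone m η hη]
  refine measureReal_mono (fun ω hω => ?_) (measure_ne_top _ _)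
  exact (reachable_v2_of_backbone m hω ha).symm.trans (reachable_v2_of_backbone m hω ha')

/-- Lower bound on the mean: `m (1 − η) ≤ EN`. -/
theorem mean_geR : (m : ℝ) * (1 - η) ≤
    ∑ a ∈ Finset.univ.erase (v0 m), (prodBernoulli (wtR m η hη)).real (openConn (v0 m) a) := by
  set P := prodBernoulli (wtR m η hη) with hP
  have hsub : leaves m ⊆ Finset.univ.erase (v0 m) := by
    intro j hj
    have := three_le_of_mem_leaves m hj
    exact Finset.mem_erase.2 ⟨fun h => by rw [h] at this; simp at this, Finset.mem_univ _⟩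
  have hF : P.real {ω | (((insert s(v0 m, v1 m) (backbone m) : Finset _)) :
      Set (Sym2 (Fin (m + 3)))) ⊆ ω} = 1 - η := by
    rw [hP, prodBernoulli_real_subset, Finset.prod_insert, wtR_01, one_mul,
      ← prodBernoulli_real_subset, prob_backbone]
    simp only [backbone, Finset.mem_insert, Finset.mem_image, not_or, not_exists, not_and]
    refine ⟨fun h => ?_, fun j hj h => ?_⟩
    · simp only [Sym2.eq_iff, Fin.ext_iff, v0_val, v1_val, v2_val] at h; omega
    · simp only [Sym2.eq_iff, Fin.ext_iff, v0_val, v1_val, v2_val] at h; omega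
  have hleaf : ∀ j ∈ leaves m, 1 - η ≤ P.real (openConn (v0 m) j) := by
    intro j hj
    rw [← hF]
    refine measureReal_mono (fun ω hω => ?_) (measure_ne_top _ _)
    simp only [Finset.coe_insert, Set.mem_setOf_eq, Set.insert_subset_iff] at hω
    have h01 : (openGraph ω).Adj (v0 m) (v1 m) :=
      (openGraph_adj ω _ _).2 ⟨hω.1, fun h => by simp [Fin.ext_iff] at h⟩
    have hj0 : j ≠ v0 m := fun h => by
      have := three_le_of_mem_leaves m hj; rw [h] at this; simp at this
    exact h01.reachable.trans ((reachable_v2_of_backbone m hω.2 (a := v1 m)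
      (fun h => by simp [Fin.ext_iff] at h)).symm.trans (reachable_v2_of_backbone m hω.2 hj0))
  calc (m : ℝ) * (1 - η) = ∑ j ∈ leaves m, (1 - η) := by simp [card_leaves]; ring
    _ ≤ ∑ j ∈ leaves m, P.real (openConn (v0 m) j) := Finset.sum_le_sum hleaf
    _ ≤ _ := Finset.sum_le_sum_of_subset_of_nonneg hsub fun _ _ _ => measureReal_nonneg

/-- The good event of the rate witness: finger open, `v1 v2` closed, weight-zero pairs closed. -/
def goodR : Set (Set (Sym2 (Fin (m + 3)))) :=
  {ω | s(v0 m, v1 m) ∈ ω ∧ s(v1 m, v2 m) ∉ ω ∧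
    ∀ e ∈ (Finset.univ.filter fun e => wtR m η hη e = 0), e ∉ ω}

/-- `η ≤ P(goodR)`. -/
theorem le_goodR : η ≤ (prodBernoulli (wtR m η hη)).real (goodR m η hη) := by
  set P := prodBernoulli (wtR m η hη) with hP
  have hc : P.real (goodR m η hη)ᶜ ≤ 1 - η := by
    have hsub : (goodR m η hη)ᶜ ⊆ ({ω | s(v0 m, v1 m) ∉ ω} ∪ {ω | s(v1 m, v2 m) ∈ ω}) ∪
        {ω | ∃ e ∈ (Finset.univ.filter fun e => wtR m η hη e = 0), e ∈ ω} := by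
      intro ω hω
      simp only [goodR, Set.mem_compl_iff, Set.mem_setOf_eq, not_and, not_forall, not_not] at hω
      simp only [Set.mem_union, Set.mem_setOf_eq]
      by_cases h1 : s(v0 m, v1 m) ∈ ω
      · by_cases h2 : s(v1 m, v2 m) ∈ ω
        · exact Or.inl (Or.inr h2)
        · obtain ⟨e, he, hee⟩ := hω h1 h2
          exact Or.inr ⟨e, he, hee⟩
      · exact Or.inl (Or.inl h1)
    calc P.real (goodR m η hη)ᶜ
        ≤ P.real (({ω | s(v0 m, v1 m) ∉ ω} ∪ {ω | s(v1 m, v2 m) ∈ ω}) ∪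
            {ω | ∃ e ∈ (Finset.univ.filter fun e => wtR m η hη e = 0), e ∈ ω}) :=
          measureReal_mono hsub
      _ ≤ (P.real {ω | s(v0 m, v1 m) ∉ ω} + P.real {ω | s(v1 m, v2 m) ∈ ω}) +
            P.real {ω | ∃ e ∈ (Finset.univ.filter fun e => wtR m η hη e = 0), e ∈ ω} :=
          le_trans (measureReal_union_le _ _) (add_le_add (measureReal_union_le _ _) le_rfl)
      _ ≤ ((1 - 1) + (1 - η)) + 0 := by
          gcongr
          · rw [hP, prodBernoulli_real_setOf_notMem, wtR_01]
          · rw [hP, prodBernoulli_real_setOf_mem, wtR_12]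
          · refine le_trans (prodBernoulli_real_exists_mem_le_sum _ _) (le_of_eq ?_)
            refine Finset.sum_eq_zero fun e he => ?_
            simp only [Finset.mem_filter, Finset.mem_univ, true_and] at he
            simp [he]
      _ = 1 - η := by ring
  rw [probReal_compl_eq_one_sub (measurableSet_config _)] at hc
  linarith

/-- On `goodR`, the cluster of `o = v0` meets `A` exactly in `{v1}`. -/
theorem filter_eq_of_goodR {ω : Set (Sym2 (Fin (m + 3)))} (hω : ω ∈ goodR m η hη)
    [DecidablePred fun a => ω ∈ openConn (v0 m) a] :
    (Finset.univ.erase (v0 m)).filter (fun a => ω ∈ openConn (v0 m) a) = {v1 m} := by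
  obtain ⟨h01, h12, hzero⟩ := hω
  have hzero' : ∀ e, wtR m η hη e = 0 → e ∉ ω := fun e he =>
    hzero e (Finset.mem_filter.2 ⟨Finset.mem_univ _, he⟩)
  have hT : ∀ x y, x ∈ ({v0 m, v1 m} : Set (Fin (m + 3))) → (openGraph ω).Adj x y →
      y ∈ ({v0 m, v1 m} : Set (Fin (m + 3))) := by
    intro x y hx hxy
    rw [openGraph_adj] at hxy
    obtain ⟨hmem, hne⟩ := hxy
    by_contra hy
    simp only [Set.mem_insert_iff, Set.mem_singleton_iff, not_or] at hy
    have hy2 : 2 ≤ y.val := by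
      rcases Nat.lt_or_ge y.val 2 with h | h
      · exfalso
        interval_cases hv : y.val
        · exact hy.1 (Fin.ext hv)
        · exact hy.2 (Fin.ext hv)
      · exact h
    rcases hx with rfl | rfl
    · exact hzero' _ (wtR_v0 m η hη y hy2) hmem
    · rcases Nat.lt_or_ge y.val 3 with h3 | h3
      · have : y = v2 m := Fin.ext (by simp; omega)
        subst this
        exact h12 hmem
      · exact hzero' _ (wtR_v1 m η hη y h3) hmem
  ext a
  simp only [Finset.mem_filter, Finset.mem_erase, Finset.mem_univ, and_true,
    Finset.mem_singleton]
  constructor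
  · rintro ⟨ha0, hreach⟩
    have hmemT := mem_of_reachable_of_closed hT hreach (by simp)
    simp only [Set.mem_insert_iff, Set.mem_singleton_iff] at hmemT
    exact hmemT.resolve_left ha0
  · rintro rfl
    refine ⟨fun h => by simp [Fin.ext_iff] at h, ?_⟩
    exact SimpleGraph.Adj.reachable ((openGraph_adj ω _ _).2 ⟨h01, fun h => by simp [Fin.ext_iff] at h⟩)

end RateWitness

open scoped Classical in
/-- **The rate obstruction.** For every `0 < ε < 1` and every `δ > ε` there is an instance
satisfying both hypotheses at level `δ` whose bad event has probability `≥ ε`: the rate witness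
`R_{m,ε}` with `m > 1/(1 − ε)`. Hence any valid `δ(ε)` of the crux satisfies `δ(ε) ≤ ε`; with C.2
(`δ = ε/16` suffices under `AdditiveGluing`) the optimal rate is linear, granted 4576. [folklore] -/
theorem exists_bad_ge (ε δ : ℝ) (hε0 : 0 < ε) (hε1 : ε < 1) (hεδ : ε < δ) :
    ∃ (n : ℕ) (w : Sym2 (Fin n) → unitInterval) (A : Finset (Fin n)) (o : Fin n),
      1 - δ < (prodBernoulli w).real (⋃ a ∈ A, openConn o a) ∧
      (∀ a ∈ A, ∀ a' ∈ A, 1 - δ < (prodBernoulli w).real (openConn a a')) ∧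
      ε ≤ (prodBernoulli w).real {ω | 1 ≤ (A.filter fun a => ω ∈ openConn o a).card ∧
        ((A.filter fun a => ω ∈ openConn o a).card : ℝ) <
          δ * (∑ a ∈ A, (prodBernoulli w).real (openConn o a)) / ε} := by
  classical
  have hη : ε ∈ Set.Icc (0 : ℝ) 1 := ⟨hε0.le, hε1.le⟩
  obtain ⟨m, hm⟩ := exists_nat_gt (1 / (1 - ε))
  have hm1 : 1 < (m : ℝ) * (1 - ε) := by
    rw [div_lt_iff₀ (by linarith)] at hm; linarith
  refine ⟨m + 3, wtR m ε hη, Finset.univ.erase (v0 m), v0 m, ?_, ?_, ?_⟩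
  · have h1 : (prodBernoulli (wtR m ε hη)).real {ω | s(v0 m, v1 m) ∈ ω} = 1 := by
      rw [prodBernoulli_real_setOf_mem, wtR_01]
    have hle : (1 : ℝ) ≤ (prodBernoulli (wtR m ε hη)).real
        (⋃ a ∈ Finset.univ.erase (v0 m), openConn (v0 m) a) := by
      rw [← h1]
      refine measureReal_mono (fun ω hω => ?_) (measure_ne_top _ _)
      simp only [Set.mem_setOf_eq] at hω
      simp only [Set.mem_iUnion, exists_prop, Finset.mem_erase, Finset.mem_univ, and_true]
      refine ⟨v1 m, fun h => by simp [Fin.ext_iff] at h, ?_⟩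
      exact SimpleGraph.Adj.reachable ((openGraph_adj ω _ _).2 ⟨hω, fun h => by simp [Fin.ext_iff] at h⟩)
    linarith
  · intro a ha a' ha'
    exact lt_of_lt_of_le (by linarith) (pair_geR m ε hη (Finset.mem_erase.1 ha).1
      (Finset.mem_erase.1 ha').1)
  · refine le_trans (le_goodR m ε hη) (measureReal_mono (fun ω hω => ?_) (measure_ne_top _ _))
    have hmean := mean_geR m ε hη
    simp only [Set.mem_setOf_eq]
    rw [filter_eq_of_goodR m ε hη hω, Finset.card_singleton]
    refine ⟨le_rfl, ?_⟩
    push_cast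
    rw [lt_div_iff₀ hε0]
    have hEN : (1 : ℝ) < ∑ a ∈ Finset.univ.erase (v0 m),
        (prodBernoulli (wtR m ε hη)).real (openConn (v0 m) a) := lt_of_lt_of_le hm1 hmean
    nlinarith

open scoped Classical in
/-- The crux with a PRESCRIBED linear rate `δ = κ ε`. -/
def NoHeavyLowerTailRate (κ : ℝ) : Prop :=
  ∀ ε : ℝ, 0 < ε → ∀ (n : ℕ) (w : Sym2 (Fin n) → unitInterval) (A : Finset (Fin n)) (o : Fin n),
    1 - κ * ε < (prodBernoulli w).real (⋃ a ∈ A, openConn o a) →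
      (∀ a ∈ A, ∀ a' ∈ A, 1 - κ * ε < (prodBernoulli w).real (openConn a a')) →
        (prodBernoulli w).real {ω | 1 ≤ (A.filter fun a => ω ∈ openConn o a).card ∧
          ((A.filter fun a => ω ∈ openConn o a).card : ℝ) <
            κ * ε * (∑ a ∈ A, (prodBernoulli w).real (openConn o a)) / ε} < ε

/-- **Refuted strengthening: no rate `δ = κ ε` with `κ > 1`** (rate witness at `ε = 1/2`).
By C.2, `κ = 1/16` works under `AdditiveGluing`. [folklore] -/
theorem not_noHeavyLowerTailRate {κ : ℝ} (hκ : 1 < κ) : ¬ NoHeavyLowerTailRate κ := by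
  intro h
  obtain ⟨n, w, A, o, h1, h2, h3⟩ :=
    exists_bad_ge (1 / 2) (κ * (1 / 2)) (by norm_num) (by norm_num) (by linarith)
  have := h (1 / 2) (by norm_num) n w A o h1 h2
  linarith

/-! ## E. Where the content is: only unboundedly large relay sets matter -/

open scoped Classical in
/-- **For relay sets of bounded size the event is EMPTY** once `δ ≤ ε/(K+1)` (`N ≤ |A|`,
`EN ≤ |A| ≤ K` force `δ·EN/ε < 1 ≤ N`): no hypothesis on the graph is used. All the content
of the crux is the uniformity in `|A|` (equivalently in `n`). [folklore] -/
theorem bad_empty_of_card_le (K : ℕ) {ε : ℝ} (hε : 0 < ε) :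
    ∃ δ : ℝ, 0 < δ ∧ ∀ (n : ℕ) (w : Sym2 (Fin n) → unitInterval) (A : Finset (Fin n)) (o : Fin n),
      A.card ≤ K →
        (prodBernoulli w).real {ω | 1 ≤ (A.filter fun a => ω ∈ openConn o a).card ∧
          ((A.filter fun a => ω ∈ openConn o a).card : ℝ) <
            δ * (∑ a ∈ A, (prodBernoulli w).real (openConn o a)) / ε} = 0 := by
  classical
  refine ⟨ε / (K + 1), by positivity, ?_⟩
  intro n w A o hK
  set P := prodBernoulli w with hP
  have hEN : (∑ a ∈ A, P.real (openConn o a)) ≤ K := by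
    calc (∑ a ∈ A, P.real (openConn o a)) ≤ ∑ a ∈ A, (1 : ℝ) :=
          Finset.sum_le_sum fun a _ => measureReal_le_one
      _ = A.card := by simp
      _ ≤ K := by exact_mod_cast hK
  refine le_antisymm (le_trans (measureReal_mono (fun ω hω => ?_) (measure_ne_top _ _))
    (le_of_eq (measureReal_empty (μ := P)))) measureReal_nonneg
  simp only [Set.mem_setOf_eq] at hω
  obtain ⟨h1, h2⟩ := hω
  have h1' : (1 : ℝ) ≤ ((A.filter fun a => ω ∈ openConn o a).card : ℝ) := by exact_mod_cast h1
  have hlt : ε / (K + 1) * (∑ a ∈ A, P.real (openConn o a)) / ε < 1 := by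
    rw [div_lt_one hε]
    have hK1 : (0 : ℝ) < K + 1 := by positivity
    calc ε / (K + 1) * (∑ a ∈ A, P.real (openConn o a)) ≤ ε / (K + 1) * K := by gcongr
      _ < ε := by rw [div_mul_eq_mul_div, div_lt_iff₀ hK1]; nlinarith
  exact absurd (lt_of_le_of_lt h1' (lt_trans h2 hlt)) (lt_irrefl _)

end Summit.CriticalPhenomena.PercolationContinuityZ3.Cruxes.NoHeavyLowerTail.Disproof
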